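import Literature.NumberTheory.Automorphic.CDTTheorem712
import Literature.NumberTheory.EllipticCurves.ModFiveCongruenceHesseFamily
import Literature.NumberTheory.EllipticCurves.GaloisActionProofs
import Literature.NumberTheory.GaloisRepresentations.AbsGaloisGroup
import HarnessLib
import Literature.NumberTheory.EllipticCurves.KleinQuinticSectionTableCerts
import Literature.NumberTheory.EllipticCurves.ModFiveCongruenceHesseSyzygy
import Mathlib.Tactic.IntervalCases
import Mathlib.Tactic.LinearCombination
import Mathlib.Algebra.Polynomial.Derivative

/-!
# Fisher's Theorem 13.2 (i) for `n = 5` — PROVED VERBATIM (`thm132_geomTorsionFive_of_hesseFamily_holds`) by a linear frame on Klein's model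

k2-g18 / k3-g15 variant: the value anchor at `t = 0` (which needed `c₆ ≠ 0`) is replaced by the FIRST-ORDER anchor
(`p(0) = q(0)`, `p'(0) = q'(0)`, Klein's Jacobian identity `∂(f,T)/∂(a,b) = 30·H²`), so the extreme fibre `j = 1728` is covered and the
tree's named fact is discharged with NO restriction; `thm132_restricted_holds` (the form the road consumes) is its corollary.
Below, g17's description of the restricted argument (everything except the anchor is unchanged):

`thm132_restricted` = the tree's named fact `HesseFamilyFive.thm132_geomTorsionFive_of_hesseFamily`
(Fisher 2012 Thm 13.2 (i) / Fisher 2013 Thm 5.8 (i), `n = 5`: `E : y² = x³ − 27c₄x − 54c₆` and the member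
`E' : y² = x³ − 27𝔠₄(l,m)x − 54𝔠₆(l,m)` of the Hesse family have `Γ_ℚ`-isomorphic `5`-torsion,
`Congr E' E`) RESTRICTED to `c₆ ≠ 0`, and

  `theorem thm132_restricted_holds : thm132_restricted`.

Proof (this file): over `𝕃 = ℚ̄` every such `E` is a twist-free KLEIN MODEL `y² = x³ − 27·5⁴kC4(a,b)x − 54·5⁶kC6(a,b)`
(`IsKleinModel`; `c₆ ≠ 0` excludes the degenerate vertex/edge orbits), the Hesse member at `(l, m)` is the
Klein model at a LINEARLY transformed `(a, b)` (sign rigidity of the invariants, the syzygy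
`ModFiveCongruenceHesseSyzygy.hesse5_syzygy`), and the certified SECTION TABLE
(`KleinQuinticSectionTable.table_chainCertified`: explicit `5`-torsion sections natural in `(a, b)` with
chord/tangent certificates) gives a `Γ_ℚ`-equivariant FRAME `E'[5] ≃+ E[5]` (`congr_of_segmentFrame`).
The bottom line feeds the `3`–`5` switch road (`CDTThreeFiveSwitchProofs`), which calls Fisher (i) only
in its branch `c₆ ≠ 0`.

Provenance: crux workfile `Summits/ABC/ABC/Cruxes/FreyModularity/STUB_IDEAS_stub_switch_3g13_LinearFrame.lean`
with: namespace ↦ `Literature.NumberTheory.EllipticCurves.KleinQuinticTorsion` (shared with `KleinQuinticSectionTable`, whose character-identical copies of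
`kD kC4 kC6` and of the interface `SectionTable … ChainCertified` replace this file's), the sorried
`table_chainCertified` deleted (the table module proves it), `hesse_syzygy_LM` taken by name from
`ModFiveCongruenceHesseSyzygy`, `thm132_restricted_holds` appended.  Whole chain kernel-checked as one
file (k3 g14 "D": rc 0, 0 sorry, axioms propext / Classical.choice / Quot.sound).
Revision r1 (pre-empting the review points that bounced `CDTThreeFiveSwitchDescent` p844579): no linter
is disabled (the unused simp arguments are removed instead); nothing PUBLIC in the tree is restated.

## References
* [Fisher2012Hessian] T. Fisher, The Hessian of a genus one curve, Proc. LMS 104 (2012), Thm 13.2 (i), §8, Lemma 8.4.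
* [Fisher2013TwistsOfX5] T. Fisher, On families of n-congruent elliptic curves (2013), Thm 5.8.
* [SilvermanAEC2009] J. Silverman, AEC, III §1–§3, X §5 (twists).
-/


namespace Literature.NumberTheory.EllipticCurves.KleinQuinticTorsion

open _root_.Literature.NumberTheory.EllipticCurves _root_.Literature.NumberTheory.EllipticCurves.HesseFamilyFive
open _root_.Literature.NumberTheory.Automorphic _root_.Literature.NumberTheory.Automorphic.BCDT _root_.WeierstrassCurve
open _root_.Polynomial

local notation "𝕃" => AlgebraicClosure ℚ

/-! ## §0 Carriers (verbatim g12) + the numerator of Fisher's `𝔠₆` (NEW, for polynomiality in `t`) -/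

section Klein
variable {R : Type*} [CommRing R]

/-- `kDa` — datum of the linear-frame argument for Fisher's Theorem 13.2 (i), `n = 5` (see the module docstring). [folklore] -/
private def kDa (a b : R) : R := 11 * a ^ 10 * b - 66 * a ^ 5 * b ^ 6 - b ^ 11
/-- `kDb` — datum of the linear-frame argument for Fisher's Theorem 13.2 (i), `n = 5` (see the module docstring). [folklore] -/
private def kDb (a b : R) : R := a ^ 11 - 66 * a ^ 6 * b ^ 5 - 11 * a * b ^ 10
/-- `Mv1` — datum of the linear-frame argument for Fisher's Theorem 13.2 (i), `n = 5` (see the module docstring). [folklore] -/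
private def Mv1 (a b l m : R) : R := l * a - m * kDb a b
/-- `Mv2` — datum of the linear-frame argument for Fisher's Theorem 13.2 (i), `n = 5` (see the module docstring). [folklore] -/
private def Mv2 (a b l m : R) : R := l * b + m * kDa a b

set_option maxHeartbeats 4000000 in
/-- `klein_syzygy` — step of the linear-frame argument for Fisher's Theorem 13.2 (i), `n = 5` (see the module docstring). [folklore] -/
private theorem klein_syzygy (a b : R) : kC4 a b ^ 3 - kC6 a b ^ 2 = 1728 * kD a b ^ 5 := by
  simp only [kD, kC4, kC6]; ring

/-- `map_kC4` — step of the linear-frame argument for Fisher's Theorem 13.2 (i), `n = 5` (see the module docstring). [folklore] -/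
private theorem map_kC4 {S : Type*} [CommRing S] (f : R →+* S) (a b : R) :
    f (kC4 a b) = kC4 (f a) (f b) := by
  simp only [kC4, map_add, map_sub, map_mul, map_pow, map_ofNat]

/-- `map_kD` — step of the linear-frame argument for Fisher's Theorem 13.2 (i), `n = 5` (see the module docstring). [folklore] -/
private theorem map_kD {S : Type*} [CommRing S] (f : R →+* S) (a b : R) :
    f (kD a b) = kD (f a) (f b) := by
  simp only [kD, map_sub, map_mul, map_pow, map_ofNat]

/-- `map_kC6` — step of the linear-frame argument for Fisher's Theorem 13.2 (i), `n = 5` (see the module docstring). [folklore] -/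
private theorem map_kC6 {S : Type*} [CommRing S] (f : R →+* S) (a b : R) :
    f (kC6 a b) = kC6 (f a) (f b) := by
  simp only [kC6, map_add, map_sub, map_neg, map_mul, map_pow, map_ofNat]

/-- `seg_eq_Mv` — step of the linear-frame argument for Fisher's Theorem 13.2 (i), `n = 5` (see the module docstring). [folklore] -/
private theorem seg_eq_Mv (a b l m t : R) :
    (1 - t) * a + t * Mv1 a b l m = Mv1 a b (1 - t + t * l) (t * m) ∧
    (1 - t) * b + t * Mv2 a b l m = Mv2 a b (1 - t + t * l) (t * m) := by
  constructor <;> simp only [Mv1, Mv2] <;> ring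

/-- NEW: the NUMERATOR of Fisher's `𝔠₆ = (𝔇_λ 𝔠₄,μ − 𝔇_μ 𝔠₄,λ)/240`, `𝔠₄,• = −(…)/17424`, over any
commutative ring (the tree's `C6` needs a field: it divides by `17424·240 = 4181760`). [folklore] -/
private def C6N (c₄ c₆ l m : R) : R :=
  Dl c₄ c₆ l m * (-(Dllm c₄ c₆ l m * Dmm c₄ c₆ l m + Dll c₄ c₆ l m * Dmmm c₄ c₆ l m
      - 2 * Dlm c₄ c₆ l m * Dlmm c₄ c₆ l m))
    - Dm c₄ c₆ l m * (-(Dlll c₄ c₆ l m * Dmm c₄ c₆ l m + Dll c₄ c₆ l m * Dlmm c₄ c₆ l m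
      - 2 * Dlm c₄ c₆ l m * Dllm c₄ c₆ l m))

/-- `map_C6N` — step of the linear-frame argument for Fisher's Theorem 13.2 (i), `n = 5` (see the module docstring). [folklore] -/
private theorem map_C6N {S : Type*} [CommRing S] (f : R →+* S) (c₄ c₆ l m : R) :
    f (C6N c₄ c₆ l m) = C6N (f c₄) (f c₆) (f l) (f m) := by
  simp only [C6N, Dl, Dm, Dll, Dlm, Dmm, Dlll, Dllm, Dlmm, Dmmm, map_add, map_sub, map_neg, map_mul,
    map_pow, map_ofNat]


/-- Euler for Klein's `D` (PROVED g9, verbatim). [folklore] -/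
private theorem klein_euler (a b : R) : a * kDa a b + b * kDb a b = 12 * kD a b := by
  simp only [kD, kDa, kDb]; ring

/-- `kD_smul` — step of the linear-frame argument for Fisher's Theorem 13.2 (i), `n = 5` (see the module docstring). [folklore] -/
private theorem kD_smul (s a b : R) : kD (s * a) (s * b) = s ^ 12 * kD a b := by
  simp only [kD]; ring
/-- `kC4_smul` — step of the linear-frame argument for Fisher's Theorem 13.2 (i), `n = 5` (see the module docstring). [folklore] -/
private theorem kC4_smul (s a b : R) : kC4 (s * a) (s * b) = s ^ 20 * kC4 a b := by
  simp only [kC4]; ring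
/-- `kC6_smul` — step of the linear-frame argument for Fisher's Theorem 13.2 (i), `n = 5` (see the module docstring). [folklore] -/
private theorem kC6_smul (s a b : R) : kC6 (s * a) (s * b) = s ^ 30 * kC6 a b := by
  simp only [kC6]; ring

set_option maxHeartbeats 40000000 in
/-- **L84-D (PROVED g9, `ring` ≈ 20 s; verbatim).** [Fisher2012Hessian Lemma 8.4 p.12] [folklore] -/
private theorem lemma84_D (a b l m : R) :
    D (kC4 a b) (kC6 a b) l m * kD a b = kD (Mv1 a b l m) (Mv2 a b l m) := by
  simp only [D, kC4, kC6, kD, Mv1, Mv2, kDa, kDb]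
  ring

/-- second partials of Klein's `D` (g9). [folklore] -/
private def kDaa (a b : R) : R := 110 * a ^ 9 * b - 330 * a ^ 4 * b ^ 6
/-- `kDab` — datum of the linear-frame argument for Fisher's Theorem 13.2 (i), `n = 5` (see the module docstring). [folklore] -/
private def kDab (a b : R) : R := 11 * a ^ 10 - 396 * a ^ 5 * b ^ 5 - 11 * b ^ 10
/-- `kDbb` — datum of the linear-frame argument for Fisher's Theorem 13.2 (i), `n = 5` (see the module docstring). [folklore] -/
private def kDbb (a b : R) : R := -330 * a ^ 6 * b ^ 4 - 110 * a * b ^ 9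

/-- Klein: `Hess(D) = −121·c₄^{Kl}` (g9; kit j345457 A3). [folklore] -/
private theorem klein_hessian (a b : R) : kDaa a b * kDbb a b - kDab a b ^ 2 = -121 * kC4 a b := by
  simp only [kDaa, kDab, kDbb, kC4]; ring

set_option maxHeartbeats 40000000 in
/-- `∂²/∂λ²` of L84-D (g9, verbatim). [folklore] -/
private theorem chain_ll (a b l m : R) :
    Dll (kC4 a b) (kC6 a b) l m * kD a b =
      a ^ 2 * kDaa (Mv1 a b l m) (Mv2 a b l m) + 2 * a * b * kDab (Mv1 a b l m) (Mv2 a b l m)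
        + b ^ 2 * kDbb (Mv1 a b l m) (Mv2 a b l m) := by
  simp only [Dll, kC4, kC6, kD, kDaa, kDab, kDbb, Mv1, Mv2, kDa, kDb]; ring

set_option maxHeartbeats 40000000 in
/-- `∂²/∂λ∂μ` of L84-D (g9, verbatim). [folklore] -/
private theorem chain_lm (a b l m : R) :
    Dlm (kC4 a b) (kC6 a b) l m * kD a b =
      -(a * kDb a b) * kDaa (Mv1 a b l m) (Mv2 a b l m)
        + (a * kDa a b - b * kDb a b) * kDab (Mv1 a b l m) (Mv2 a b l m)
        + b * kDa a b * kDbb (Mv1 a b l m) (Mv2 a b l m) := by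
  simp only [Dlm, kC4, kC6, kD, kDaa, kDab, kDbb, Mv1, Mv2, kDa, kDb]; ring

set_option maxHeartbeats 40000000 in
/-- `∂²/∂μ²` of L84-D (g9, verbatim). [folklore] -/
private theorem chain_mm (a b l m : R) :
    Dmm (kC4 a b) (kC6 a b) l m * kD a b =
      kDb a b ^ 2 * kDaa (Mv1 a b l m) (Mv2 a b l m)
        - 2 * kDa a b * kDb a b * kDab (Mv1 a b l m) (Mv2 a b l m)
        + kDa a b ^ 2 * kDbb (Mv1 a b l m) (Mv2 a b l m) := by
  simp only [Dmm, kC4, kC6, kD, kDaa, kDab, kDbb, Mv1, Mv2, kDa, kDb]; ring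


end Klein

/-- `𝔠₆ = C6N / 4181760` in any field (PROVED, `ring` on atoms). [folklore] -/
private theorem C6_eq_C6N_div {F : Type*} [Field F] [CharZero F] (c₄ c₆ l m : F) :
    C6 c₄ c₆ l m = C6N c₄ c₆ l m / 4181760 := by
  simp only [C6, C4l, C4m, C6N]
  field_simp
  ring

/-! ## §1 TWO ENGINES (PROVED): rigidity by pigeonhole (g12) and SIGN rigidity (NEW) -/

/-- `rigidity_engine` — step of the linear-frame argument for Fisher's Theorem 13.2 (i), `n = 5` (see the module docstring). [folklore] -/
private theorem rigidity_engine {L : Type*} [CommRing L] [IsDomain L] {Λ : Type*} [Finite Λ] {ι : Type*}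
    (S : Set L) (hS : S.Infinite) (P : ι → L[X]) (Q : Λ → ι → L[X])
    (h : ∀ t ∈ S, ∃ y, ∀ i, (P i).eval t = (Q y i).eval t) : ∃ y, ∀ i, P i = Q y i := by
  classical
  haveI : Infinite S := hS.to_subtype
  choose f hf using fun t : S => h t.1 t.2
  obtain ⟨y, hy⟩ := Finite.exists_infinite_fiber f
  refine ⟨y, fun i => Polynomial.eq_of_infinite_eval_eq (P i) (Q y i) ?_⟩
  have hinf : Set.Infinite (Subtype.val '' (f ⁻¹' {y} : Set S)) :=
    (Set.infinite_coe_iff.mp hy).image Subtype.val_injective.injOn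
  refine hinf.mono ?_
  rintro _ ⟨t, ht, rfl⟩
  have h1 := hf t i
  rw [Set.mem_preimage, Set.mem_singleton_iff] at ht
  rw [ht] at h1
  exact h1

/-- **SIGN RIGIDITY (NEW, PROVED).** Two polynomials whose squares agree on an infinite set agree up
to ONE global sign. [folklore] -/
private theorem sign_rigidity {L : Type*} [CommRing L] [IsDomain L] (S : Set L) (hS : S.Infinite)
    (p q : L[X]) (h : ∀ t ∈ S, (p.eval t) ^ 2 = (q.eval t) ^ 2) : p = q ∨ p = -q := by
  have key := rigidity_engine S hS (fun _ : Unit => p) (fun (b : Bool) (_ : Unit) => cond b q (-q))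
    (fun t ht => by
      rcases sq_eq_sq_iff_eq_or_eq_neg.mp (h t ht) with h1 | h1
      · exact ⟨true, fun _ => by simpa using h1⟩
      · exact ⟨false, fun _ => by simpa using h1⟩)
  obtain ⟨b, hb⟩ := key
  cases b
  · right; simpa using hb ()
  · left; simpa using hb ()

/-- **ANCHORED SIGN RIGIDITY (NEW, PROVED).** … and if they agree at one point where they do not
vanish (characteristic `≠ 2`), they are equal. [folklore] -/
private theorem sign_rigidity_anchor {L : Type*} [CommRing L] [IsDomain L] [CharZero L] (S : Set L)
    (hS : S.Infinite) (p q : L[X]) (h : ∀ t ∈ S, (p.eval t) ^ 2 = (q.eval t) ^ 2) (t₀ : L)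
    (h₀ : p.eval t₀ = q.eval t₀) (hne : q.eval t₀ ≠ 0) : p = q := by
  rcases sign_rigidity S hS p q h with h1 | h1
  · exact h1
  · exfalso
    apply hne
    have e : q.eval t₀ = -q.eval t₀ := by
      have := h₀
      rw [h1, eval_neg] at this
      exact this.symm
    have h2 : (2 : L) * q.eval t₀ = 0 := by linear_combination e
    rcases mul_eq_zero.mp h2 with h3 | h3
    · exact absurd h3 two_ne_zero
    · exact h3

/-! ## §3 Klein models and the LINEAR FRAME at one torsor point (LF1) -/

/-- `sbase` — datum of the linear-frame argument for Fisher's Theorem 13.2 (i), `n = 5` (see the module docstring). [folklore] -/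
private abbrev sbase (A B : ℚ) : WeierstrassCurve ℚ := ⟨0, 0, 0, -(27 * 5 ^ 4) * A, -(54 * 5 ^ 6) * B⟩

/-- `IsKleinModel` — datum of the linear-frame argument for Fisher's Theorem 13.2 (i), `n = 5` (see the module docstring). [folklore] -/
private structure IsKleinModel (W : WeierstrassCurve ℚ) (a b : 𝕃) : Prop where
  ha₁ : W.a₁ = 0
  ha₂ : W.a₂ = 0
  ha₃ : W.a₃ = 0
  ha₄ : ((W.a₄ : ℚ) : 𝕃) = -(27 * 5 ^ 4) * kC4 a b
  ha₆ : ((W.a₆ : ℚ) : 𝕃) = -(54 * 5 ^ 6) * kC6 a b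

/-- **LF1a · secPt_nonsingular (PROVED).** `onCurve` + `Affine.equation_iff_nonsingular_of_Δ_ne_zero`. [folklore] -/
private theorem secPt_nonsingular (T : SectionTable) (hT : T.ChainCertified) (W : WeierstrassCurve ℚ)
    [W.IsElliptic] {z a b : 𝕃} (hz : z ^ 4 + z ^ 3 + z ^ 2 + z + 1 = 0) (hW : IsKleinModel W a b)
    (x : ZMod 5 × ZMod 5) (hx : x ≠ 0) :
    (W.baseChange 𝕃).toAffine.Nonsingular (T.X x 𝕃 z a b) (T.Y x 𝕃 z a b) := by
  have hΔ : (W.baseChange 𝕃).toAffine.Δ ≠ 0 := by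
    show (W.map (algebraMap ℚ 𝕃)).Δ ≠ 0
    rw [WeierstrassCurve.map_Δ]
    exact (map_ne_zero (algebraMap ℚ 𝕃)).mpr W.isUnit_Δ.ne_zero
  have e₁ : (W.baseChange 𝕃).toAffine.a₁ = 0 := by
    show algebraMap ℚ 𝕃 W.a₁ = 0
    rw [hW.ha₁, map_zero]
  have e₂ : (W.baseChange 𝕃).toAffine.a₂ = 0 := by
    show algebraMap ℚ 𝕃 W.a₂ = 0
    rw [hW.ha₂, map_zero]
  have e₃ : (W.baseChange 𝕃).toAffine.a₃ = 0 := by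
    show algebraMap ℚ 𝕃 W.a₃ = 0
    rw [hW.ha₃, map_zero]
  have e₄ : (W.baseChange 𝕃).toAffine.a₄ = -(27 * 5 ^ 4) * kC4 a b := by
    show algebraMap ℚ 𝕃 W.a₄ = _
    rw [← hW.ha₄, eq_ratCast]
  have e₆ : (W.baseChange 𝕃).toAffine.a₆ = -(54 * 5 ^ 6) * kC6 a b := by
    show algebraMap ℚ 𝕃 W.a₆ = _
    rw [← hW.ha₆, eq_ratCast]
  rw [← WeierstrassCurve.Affine.equation_iff_nonsingular_of_Δ_ne_zero hΔ,
    WeierstrassCurve.Affine.equation_iff, e₁, e₂, e₃, e₄, e₆]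
  linear_combination hT.onCurve 𝕃 z a b hz x hx

/-- The two-generator hom `𝔽₅² →+ A`, `(j,k) ↦ j·P₀ + k·P₁`, for `5`-torsion `P₀, P₁`
(`ZMod.lift` + `AddMonoidHom.coprod`; no module structure needed). [folklore] -/
private noncomputable def frameHom {A : Type*} [AddCommGroup A] (P₀ P₁ : A) (h₀ : (5 : ℤ) • P₀ = 0)
    (h₁ : (5 : ℤ) • P₁ = 0) : ZMod 5 × ZMod 5 →+ A :=
  (ZMod.lift 5 ⟨zmultiplesHom A P₀, by simpa using h₀⟩).coprod
    (ZMod.lift 5 ⟨zmultiplesHom A P₁, by simpa using h₁⟩)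

/-- `lift_five_one` — step of the linear-frame argument for Fisher's Theorem 13.2 (i), `n = 5` (see the module docstring). [folklore] -/
private theorem lift_five_one {A : Type*} [AddCommGroup A] (f : {f : ℤ →+ A // f 5 = 0}) :
    ZMod.lift 5 f 1 = f.1 1 := by
  have h := ZMod.lift_coe 5 f 1
  simpa using h

/-- `frameHom_gen0` — step of the linear-frame argument for Fisher's Theorem 13.2 (i), `n = 5` (see the module docstring). [folklore] -/
private theorem frameHom_gen0 {A : Type*} [AddCommGroup A] (P₀ P₁ : A) (h₀ : (5 : ℤ) • P₀ = 0)
    (h₁ : (5 : ℤ) • P₁ = 0) : frameHom P₀ P₁ h₀ h₁ (1, 0) = P₀ := by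
  simp [frameHom, AddMonoidHom.coprod_apply, lift_five_one]

/-- `frameHom_gen1` — step of the linear-frame argument for Fisher's Theorem 13.2 (i), `n = 5` (see the module docstring). [folklore] -/
private theorem frameHom_gen1 {A : Type*} [AddCommGroup A] (P₀ P₁ : A) (h₀ : (5 : ℤ) • P₀ = 0)
    (h₁ : (5 : ℤ) • P₁ = 0) : frameHom P₀ P₁ h₀ h₁ (0, 1) = P₁ := by
  simp [frameHom, AddMonoidHom.coprod_apply, lift_five_one]

/-- Two affine points with equal coordinates are equal (proof-irrelevance of nonsingularity). [folklore] -/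
private theorem some_congr {R : Type*} [CommRing R] {W' : Affine R} {x₁ x₂ y₁ y₂ : R}
    (h₁ : W'.Nonsingular x₁ y₁) (h₂ : W'.Nonsingular x₂ y₂) (hx : x₁ = x₂) (hy : y₁ = y₂) :
    Affine.Point.some x₁ y₁ h₁ = Affine.Point.some x₂ y₂ h₂ := by
  subst hx hy
  rfl

/-! ### LF1b/LF1c · the two CERTIFIED CHAIN STEPS (NEW, PROVED; pattern of the tree's
`Literature/NumberTheory/EllipticCurves/X049SevenTorsionFrobenius.lean: add_self_of_cert`) -/

/-- **LF1b · add_of_chordRel (PROVED).** On a model with `a₁ = a₂ = a₃ = 0`, a `ChordRel`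
certificate with `x₁ ≠ x₂` IS the chord law: `P₁ + P₂ = P₃`
(Mathlib `Affine.Point.add_of_X_ne`, `Affine.slope_of_X_ne`, `addX/addY/negAddY/negY`). [folklore] -/
private theorem add_of_chordRel {F : Type*} [Field F] [DecidableEq F] {W' : Affine F} (h₁ : W'.a₁ = 0)
    (h₂ : W'.a₂ = 0) (h₃ : W'.a₃ = 0) {x₁ y₁ x₂ y₂ x₃ y₃ : F} (hP : W'.Nonsingular x₁ y₁)
    (hQ : W'.Nonsingular x₂ y₂) (hR : W'.Nonsingular x₃ y₃) (hx : x₁ ≠ x₂)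
    (hC : ChordRel x₁ y₁ x₂ y₂ x₃ y₃) :
    (Affine.Point.some x₁ y₁ hP : W'.Point) + Affine.Point.some x₂ y₂ hQ =
      Affine.Point.some x₃ y₃ hR := by
  rw [Affine.Point.add_of_X_ne hx]
  set ℓ := W'.slope x₁ x₂ y₁ y₂ with hℓdef
  have hd : x₁ - x₂ ≠ 0 := sub_ne_zero.mpr hx
  have hℓD : ℓ * (x₁ - x₂) = y₁ - y₂ := by
    rw [hℓdef, Affine.slope_of_X_ne hx, div_mul_cancel₀ _ hd]
  have hXe : W'.addX x₁ x₂ ℓ = x₃ := by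
    have e : (ℓ ^ 2 - x₁ - x₂) * (x₁ - x₂) ^ 2 = x₃ * (x₁ - x₂) ^ 2 := by
      linear_combination (ℓ * (x₁ - x₂) + (y₁ - y₂)) * hℓD - hC.1
    rw [Affine.addX, h₁, h₂]
    linear_combination (mul_right_cancel₀ (pow_ne_zero 2 hd) e)
  have hYe : W'.addY x₁ x₂ y₁ ℓ = y₃ := by
    rw [Affine.addY, Affine.negY, Affine.negAddY, hXe, h₁, h₃]
    have e : (-(ℓ * (x₃ - x₁) + y₁)) * (x₁ - x₂) = y₃ * (x₁ - x₂) := by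
      linear_combination (-(x₃ - x₁)) * hℓD - hC.2
    linear_combination (mul_right_cancel₀ hd e)
  exact some_congr _ _ hXe hYe

/-- **LF1c · add_self_of_tangentRel (PROVED).** On a model with `a₁ = a₂ = a₃ = 0`, a `TangentRel`
certificate with `2y₁ ≠ 0` IS the duplication law: `P₁ + P₁ = P₂`
(Mathlib `Affine.Point.add_self_of_Y_ne`, `Affine.slope_of_Y_ne`). [folklore] -/
private theorem add_self_of_tangentRel {F : Type*} [Field F] [DecidableEq F] {W' : Affine F}
    (h₁ : W'.a₁ = 0) (h₂ : W'.a₂ = 0) (h₃ : W'.a₃ = 0) {x₁ y₁ x₂ y₂ : F} (hP : W'.Nonsingular x₁ y₁)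
    (hQ : W'.Nonsingular x₂ y₂) (hD : 2 * y₁ ≠ 0) (hT : TangentRel W'.a₄ x₁ y₁ x₂ y₂) :
    (Affine.Point.some x₁ y₁ hP : W'.Point) + Affine.Point.some x₁ y₁ hP =
      Affine.Point.some x₂ y₂ hQ := by
  have hneg : W'.negY x₁ y₁ = -y₁ := by rw [Affine.negY, h₁, h₃]; ring
  have hyne : y₁ ≠ W'.negY x₁ y₁ := by
    rw [hneg]; intro h; apply hD; linear_combination h
  rw [Affine.Point.add_self_of_Y_ne hyne]
  set ℓ := W'.slope x₁ x₁ y₁ y₁ with hℓdef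
  have hℓ : ℓ = (3 * x₁ ^ 2 + 2 * W'.a₂ * x₁ + W'.a₄ - W'.a₁ * y₁) / (y₁ - W'.negY x₁ y₁) := by
    rw [hℓdef, Affine.slope_of_Y_ne rfl hyne]
  rw [hneg, h₁, h₂] at hℓ
  have hℓD : ℓ * (2 * y₁) = 3 * x₁ ^ 2 + W'.a₄ := by
    rw [hℓ, show y₁ - -y₁ = 2 * y₁ by ring, div_mul_cancel₀ _ hD]; ring
  have hXe : W'.addX x₁ x₁ ℓ = x₂ := by
    have e : (ℓ ^ 2 - x₁ - x₁) * (2 * y₁) ^ 2 = x₂ * (2 * y₁) ^ 2 := by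
      linear_combination (ℓ * (2 * y₁) + (3 * x₁ ^ 2 + W'.a₄)) * hℓD - hT.1
    rw [Affine.addX, h₁, h₂]
    linear_combination (mul_right_cancel₀ (pow_ne_zero 2 hD) e)
  have hYe : W'.addY x₁ x₁ y₁ ℓ = y₂ := by
    rw [Affine.addY, Affine.negY, Affine.negAddY, hXe, h₁, h₃]
    have e : (-(ℓ * (x₂ - x₁) + y₁)) * (2 * y₁) = y₂ * (2 * y₁) := by
      linear_combination (-(x₂ - x₁)) * hℓD - hT.2
    linear_combination (mul_right_cancel₀ hD e)
  exact some_congr _ _ hXe hYe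

/-- **LF1d · order five from the chain (PROVED).** `2P = Q`, `Q + P = R`, `R = −Q` give `5 • P = 0`. [folklore] -/
private theorem five_smul_eq_zero_of_chain {A : Type*} [AddCommGroup A] {P Q R : A} (h2 : P + P = Q)
    (h3 : Q + P = R) (hneg : R = -Q) : (5 : ℤ) • P = 0 := by
  have h2' : (2 : ℤ) • P = Q := by rw [two_zsmul]; exact h2
  have h3' : (3 : ℤ) • P = R := by
    rw [show (3 : ℤ) = 2 + 1 by norm_num, add_zsmul, h2', one_zsmul]; exact h3
  have : (5 : ℤ) • P = (3 : ℤ) • P + (2 : ℤ) • P := by rw [← add_zsmul]; norm_num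
  rw [this, h3', h2', hneg, neg_add_cancel]

/-- one generator's multiples from the chain `e, 2e, 3e = −2e`, hence `5e = 0`, `4e = −e` (PROVED). [folklore] -/
private theorem multiples_of_chain {A : Type*} [AddCommGroup A] (s : ZMod 5 → A)
    (hneg : ∀ j, s (-j) = -s j) (h2 : s 1 + s 1 = s 2) (h3 : s 2 + s 1 = s 3) :
    (5 : ℤ) • s 1 = 0 ∧ ∀ j : ZMod 5, j ≠ 0 → j.val • s 1 = s j := by
  have h32 : s 3 = -s 2 := by rw [← hneg]; rfl
  have h5 : (5 : ℤ) • s 1 = 0 := five_smul_eq_zero_of_chain h2 h3 h32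
  have h5' : 5 • s 1 = 0 := by
    have := h5; rwa [show (5 : ℤ) = ((5 : ℕ) : ℤ) by rfl, natCast_zsmul] at this
  have e2 : 2 • s 1 = s 2 := by rw [two_nsmul, h2]
  have e3 : 3 • s 1 = s 3 := by rw [show 3 = 2 + 1 by rfl, succ_nsmul, e2, h3]
  have e4 : 4 • s 1 = s 4 := by
    have h54 : 5 • s 1 = 4 • s 1 + s 1 := succ_nsmul (s 1) 4
    rw [h5'] at h54
    have : 4 • s 1 = -s 1 := eq_neg_of_add_eq_zero_left h54.symm
    rw [this, ← hneg]; rfl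
  refine ⟨h5, fun j hj => ?_⟩
  obtain ⟨n, hn, rfl⟩ : ∃ n : ℕ, n < 5 ∧ (n : ZMod 5) = j := ⟨j.val, j.val_lt, ZMod.natCast_zmod_val j⟩
  rw [ZMod.val_natCast, Nat.mod_eq_of_lt hn]
  interval_cases n
  · exact absurd rfl hj
  · rw [one_nsmul, Nat.cast_one]
  · exact e2
  · exact e3
  · exact e4

/-- **LF1e · frame values from the chain (PROVED, pure algebra).** For ANY map `s : 𝔽₅² → A` into an
abelian group satisfying the chain relations (odd, two doublings, two triples, the 16 chords), both
generators are `5`-torsion and `j·s(e₀) + k·s(e₁) = s(j,k)` for `(j,k) ≠ 0` — the index bookkeeping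
of LF1, once and for all. [folklore] -/
private theorem frame_values_of_chain {A : Type*} [AddCommGroup A] (s : ZMod 5 × ZMod 5 → A)
    (hneg : ∀ x, s (-x) = -s x)
    (h2 : ∀ i : Fin 2, s (gen i) + s (gen i) = s (gen i + gen i))
    (h3 : ∀ i : Fin 2, s (gen i + gen i) + s (gen i) = s (gen i + gen i + gen i))
    (hchord : ∀ j k : ZMod 5, j ≠ 0 → k ≠ 0 → s (j, 0) + s (0, k) = s (j, k)) :
    (∀ i, (5 : ℤ) • s (gen i) = 0) ∧
      ∀ x : ZMod 5 × ZMod 5, x ≠ 0 → x.1.val • s (gen 0) + x.2.val • s (gen 1) = s x := by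
  have a2 : gen 0 + gen 0 = ((2 : ZMod 5), (0 : ZMod 5)) := by decide
  have a3 : gen 0 + gen 0 + gen 0 = ((3 : ZMod 5), (0 : ZMod 5)) := by decide
  have b2 : gen 1 + gen 1 = ((0 : ZMod 5), (2 : ZMod 5)) := by decide
  have b3 : gen 1 + gen 1 + gen 1 = ((0 : ZMod 5), (3 : ZMod 5)) := by decide
  have R := multiples_of_chain (fun j => s (j, 0)) (fun j => by simpa using hneg (j, 0))
    (by have := h2 0; rw [a2] at this; exact this)
    (by have := h3 0; rw [a3, a2] at this; exact this)
  have C := multiples_of_chain (fun k => s (0, k)) (fun k => by simpa using hneg (0, k))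
    (by have := h2 1; rw [b2] at this; exact this)
    (by have := h3 1; rw [b3, b2] at this; exact this)
  refine ⟨fun i => ?_, fun x hx => ?_⟩
  · fin_cases i
    · simpa [gen] using R.1
    · simpa [gen] using C.1
  · obtain ⟨j, k⟩ := x
    have g0 : s (gen 0) = s (1, 0) := rfl
    have g1 : s (gen 1) = s (0, 1) := rfl
    rw [g0, g1]
    by_cases hj : j = 0
    · subst hj
      have hk : k ≠ 0 := fun hk => hx (by rw [hk]; rfl)
      simp only [ZMod.val_zero, zero_nsmul, zero_add]
      exact C.2 k hk
    by_cases hk : k = 0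
    · subst hk
      simp only [ZMod.val_zero, zero_nsmul, add_zero]
      exact R.2 j hj
    rw [R.2 j hj, C.2 k hk]
    exact hchord j k hj hk

/-- The coefficients of the base-changed Klein model (PROVED). [folklore] -/
private theorem baseChange_coeffs (W : WeierstrassCurve ℚ) {a b : 𝕃} (hW : IsKleinModel W a b) :
    (W.baseChange 𝕃).toAffine.a₁ = 0 ∧ (W.baseChange 𝕃).toAffine.a₂ = 0 ∧
      (W.baseChange 𝕃).toAffine.a₃ = 0 ∧ (W.baseChange 𝕃).toAffine.a₄ = -(27 * 5 ^ 4) * kC4 a b := by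
  refine ⟨?_, ?_, ?_, ?_⟩
  · show algebraMap ℚ 𝕃 W.a₁ = 0
    rw [hW.ha₁, map_zero]
  · show algebraMap ℚ 𝕃 W.a₂ = 0
    rw [hW.ha₂, map_zero]
  · show algebraMap ℚ 𝕃 W.a₃ = 0
    rw [hW.ha₃, map_zero]
  · show algebraMap ℚ 𝕃 W.a₄ = _
    rw [← hW.ha₄, eq_ratCast]

/-- The section map `x ↦ s_x` (`0 ↦ O`) into the geometric points. [folklore] -/
private noncomputable def secFun (T : SectionTable) (hT : T.ChainCertified) (W : WeierstrassCurve ℚ)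
    [W.IsElliptic] {z a b : 𝕃} (hz : z ^ 4 + z ^ 3 + z ^ 2 + z + 1 = 0) (hW : IsKleinModel W a b)
    (x : ZMod 5 × ZMod 5) : geomPoints W :=
  if hx : x = 0 then 0 else
    (Affine.Point.some (T.X x 𝕃 z a b) (T.Y x 𝕃 z a b) (secPt_nonsingular T hT W hz hW x hx) :
      (W.baseChange 𝕃).toAffine.Point)

/-- `secFun_of_ne` — step of the linear-frame argument for Fisher's Theorem 13.2 (i), `n = 5` (see the module docstring). [folklore] -/
private theorem secFun_of_ne (T : SectionTable) (hT : T.ChainCertified) (W : WeierstrassCurve ℚ)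
    [W.IsElliptic] {z a b : 𝕃} (hz : z ^ 4 + z ^ 3 + z ^ 2 + z + 1 = 0) (hW : IsKleinModel W a b)
    (x : ZMod 5 × ZMod 5) (hx : x ≠ 0) :
    secFun T hT W hz hW x =
      (Affine.Point.some (T.X x 𝕃 z a b) (T.Y x 𝕃 z a b) (secPt_nonsingular T hT W hz hW x hx) :
        (W.baseChange 𝕃).toAffine.Point) :=
  dif_neg hx

/-- `gen_ne_zero` — step of the linear-frame argument for Fisher's Theorem 13.2 (i), `n = 5` (see the module docstring). [folklore] -/
private theorem gen_ne_zero (i : Fin 2) : gen i ≠ 0 := by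
  fin_cases i <;> decide

/-- Every `x ∈ 𝔽₅²` is the `ℕ`-combination `x.1.val·e₀ + x.2.val·e₁` (finite check). [folklore] -/
private theorem decomp_gen (x : ZMod 5 × ZMod 5) : x = x.1.val • gen 0 + x.2.val • gen 1 := by
  revert x
  decide

open scoped Classical in
/-- **LF1 · frame (M−; THE CHAIN).** At a torsor point with `D^{Kl} ≠ 0` there is an ADDITIVE
`φ : 𝔽₅² →+ W[5]`, bijective, with `φ(x) = s_x` for `x ≠ 0`.
Proof plan: `P_i := s_{gen i}` (points by LF1a); `2P_i = s_{2 gen i}` (`tangent`, `ndgY`, Mathlib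
`Affine.Point.add_self_of_Y_ne` / `addX, addY, slope_of_Y_ne`); `3P_i = s_{3 gen i}` (`triple`,
`ndgX_gen`, `add_of_X_ne`); `sign` gives `s_{3 gen i} = −s_{2 gen i}`, so `5P_i = 0`, and
`4P_i = −P_i = s_{4 gen i}`; `φ := frameHom P₀ P₁`; `φ(j,k) = s_{(j,0)} + s_{(0,k)} = s_{(j,k)}`
(`chord`, `ndgX`); values at `x ≠ 0` are affine, so `ker φ = 0` (injective), and
`#W[5] = 25` (`card_torsionPoints_eq_sq_holds W ℚ̄ (n := 5)`) gives bijectivity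
(`Fintype.bijective_iff_injective_and_card`). [folklore] -/
private theorem frame (T : SectionTable) (hT : T.ChainCertified) (W : WeierstrassCurve ℚ) [W.IsElliptic]
    {z a b : 𝕃} (hz : z ^ 4 + z ^ 3 + z ^ 2 + z + 1 = 0) (hW : IsKleinModel W a b)
    (hD : kD a b ≠ 0) :
    ∃ φ : ZMod 5 × ZMod 5 →+ W.geomTorsion 5, Function.Bijective φ ∧
      ∀ (x : ZMod 5 × ZMod 5) (hx : x ≠ 0),
        ((φ x : W.geomTorsion 5) : geomPoints W) =
          (Affine.Point.some (T.X x 𝕃 z a b) (T.Y x 𝕃 z a b) (secPt_nonsingular T hT W hz hW x hx) :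
            (W.baseChange 𝕃).toAffine.Point) := by
  obtain ⟨e₁, e₂, e₃, e₄⟩ := baseChange_coeffs W hW
  set s := secFun T hT W hz hW with hs
  have hne : ∀ (x : ZMod 5 × ZMod 5) (hx : x ≠ 0), s x =
      (Affine.Point.some (T.X x 𝕃 z a b) (T.Y x 𝕃 z a b) (secPt_nonsingular T hT W hz hW x hx) :
        (W.baseChange 𝕃).toAffine.Point) :=
    fun x hx => secFun_of_ne T hT W hz hW x hx
  -- (odd) `s(−x) = −s(x)` : `sign_X`, `sign_Y`, `neg_some`
  have hneg : ∀ x, s (-x) = -s x := by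
    intro x
    by_cases hx : x = 0
    · subst hx
      have h00 : s 0 = 0 := by rw [hs, secFun, dif_pos rfl]
      rw [neg_zero, h00, neg_zero]
    · have hnx : -x ≠ 0 := neg_ne_zero.mpr hx
      rw [hne (-x) hnx, hne x hx]
      show (Affine.Point.some _ _ (secPt_nonsingular T hT W hz hW (-x) hnx) :
          (W.baseChange 𝕃).toAffine.Point) =
        -(Affine.Point.some _ _ (secPt_nonsingular T hT W hz hW x hx) :
          (W.baseChange 𝕃).toAffine.Point)
      rw [Affine.Point.neg_some]
      exact some_congr _ _ (hT.sign_X x 𝕃 z a b)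
        (by rw [Affine.negY, e₁, e₃, hT.sign_Y x 𝕃 z a b]; ring)
  -- (doublings) `s(e) + s(e) = s(2e)` : `tangent`, `ndgY`, LF1c
  have h2 : ∀ i : Fin 2, s (gen i) + s (gen i) = s (gen i + gen i) := by
    intro i
    have hg : gen i ≠ 0 := gen_ne_zero i
    have hgg : gen i + gen i ≠ 0 := by fin_cases i <;> decide
    rw [hne (gen i) hg, hne (gen i + gen i) hgg]
    show (Affine.Point.some _ _ (secPt_nonsingular T hT W hz hW (gen i) hg) :
          (W.baseChange 𝕃).toAffine.Point) +
        Affine.Point.some _ _ (secPt_nonsingular T hT W hz hW (gen i) hg) =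
        Affine.Point.some _ _ (secPt_nonsingular T hT W hz hW (gen i + gen i) hgg)
    refine add_self_of_tangentRel e₁ e₂ e₃ _ _ ?_ ?_
    · exact mul_ne_zero two_ne_zero (hT.ndgY 𝕃 z a b hz hD i)
    · rw [e₄]; exact hT.tangent 𝕃 z a b hz i
  -- (triples) `s(2e) + s(e) = s(3e)` : `triple`, `ndgX_gen`, LF1b
  have h3 : ∀ i : Fin 2, s (gen i + gen i) + s (gen i) = s (gen i + gen i + gen i) := by
    intro i
    have hg : gen i ≠ 0 := gen_ne_zero i
    have hgg : gen i + gen i ≠ 0 := by fin_cases i <;> decide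
    have hggg : gen i + gen i + gen i ≠ 0 := by fin_cases i <;> decide
    rw [hne (gen i) hg, hne (gen i + gen i) hgg, hne (gen i + gen i + gen i) hggg]
    show (Affine.Point.some _ _ (secPt_nonsingular T hT W hz hW (gen i + gen i) hgg) :
          (W.baseChange 𝕃).toAffine.Point) +
        Affine.Point.some _ _ (secPt_nonsingular T hT W hz hW (gen i) hg) =
        Affine.Point.some _ _ (secPt_nonsingular T hT W hz hW (gen i + gen i + gen i) hggg)
    exact add_of_chordRel e₁ e₂ e₃ _ _ _ (hT.ndgX_gen 𝕃 z a b hz hD i) (hT.triple 𝕃 z a b hz i)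
  -- (chords) `s(j,0) + s(0,k) = s(j,k)` : `chord`, `ndgX`, LF1b
  have hchord : ∀ j k : ZMod 5, j ≠ 0 → k ≠ 0 → s (j, 0) + s (0, k) = s (j, k) := by
    intro j k hj hk
    have hj0 : ((j, 0) : ZMod 5 × ZMod 5) ≠ 0 := fun h => hj (congrArg Prod.fst h)
    have hk0 : ((0, k) : ZMod 5 × ZMod 5) ≠ 0 := fun h => hk (congrArg Prod.snd h)
    have hjk : ((j, k) : ZMod 5 × ZMod 5) ≠ 0 := fun h => hj (congrArg Prod.fst h)
    rw [hne _ hj0, hne _ hk0, hne _ hjk]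
    show (Affine.Point.some _ _ (secPt_nonsingular T hT W hz hW (j, 0) hj0) :
          (W.baseChange 𝕃).toAffine.Point) +
        Affine.Point.some _ _ (secPt_nonsingular T hT W hz hW (0, k) hk0) =
        Affine.Point.some _ _ (secPt_nonsingular T hT W hz hW (j, k) hjk)
    exact add_of_chordRel e₁ e₂ e₃ _ _ _ (hT.ndgX 𝕃 z a b hz hD j k hj hk)
      (hT.chord 𝕃 z a b hz j k hj hk)
  -- LF1e: both generators are 5-torsion and the values are forced
  obtain ⟨h5, hval⟩ := frame_values_of_chain s hneg h2 h3 hchord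
  have hmem : ∀ i, s (gen i) ∈ W.geomTorsion 5 := fun i =>
    (Submodule.mem_torsionBy_iff (5 : ℤ) _).mpr (h5 i)
  set P0 : W.geomTorsion 5 := ⟨s (gen 0), hmem 0⟩ with hP0def
  set P1 : W.geomTorsion 5 := ⟨s (gen 1), hmem 1⟩ with hP1def
  have hP0 : (5 : ℤ) • P0 = 0 := Subtype.ext (h5 0)
  have hP1 : (5 : ℤ) • P1 = 0 := Subtype.ext (h5 1)
  set φ := frameHom P0 P1 hP0 hP1 with hφ
  have f0 : φ (gen 0) = P0 := by rw [hφ]; exact frameHom_gen0 P0 P1 hP0 hP1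
  have f1 : φ (gen 1) = P1 := by rw [hφ]; exact frameHom_gen1 P0 P1 hP0 hP1
  have hφx : ∀ x, φ x = x.1.val • P0 + x.2.val • P1 := by
    intro x
    conv_lhs => rw [decomp_gen x]
    rw [map_add, map_nsmul, map_nsmul, f0, f1]
  have htab : ∀ (x : ZMod 5 × ZMod 5) (hx : x ≠ 0), ((φ x : W.geomTorsion 5) : geomPoints W) =
      (Affine.Point.some (T.X x 𝕃 z a b) (T.Y x 𝕃 z a b) (secPt_nonsingular T hT W hz hW x hx) :
        (W.baseChange 𝕃).toAffine.Point) := by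
    intro x hx
    rw [hφx x]
    push_cast
    show x.1.val • s (gen 0) + x.2.val • s (gen 1) = _
    rw [hval x hx, hne x hx]
  have hinj : Function.Injective φ := by
    intro x y hxy
    by_contra hxy'
    have hd : x - y ≠ 0 := sub_ne_zero.mpr hxy'
    have h0 : φ (x - y) = 0 := by rw [map_sub, hxy, sub_self]
    have h1 := htab (x - y) hd
    rw [h0] at h1
    have h2' : (Affine.Point.some _ _ (secPt_nonsingular T hT W hz hW (x - y) hd) :
        (W.baseChange 𝕃).toAffine.Point) = 0 := by
      rw [← h1]; rfl
    exact Affine.Point.some_ne_zero _ h2'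
  have hcard : Nat.card (W.geomTorsion 5) = 5 ^ 2 :=
    card_torsionPoints_eq_sq_holds W 𝕃 (n := 5) (by norm_num)
  haveI : Finite (W.geomTorsion 5) := Nat.finite_of_card_ne_zero (by rw [hcard]; norm_num)
  have hbij : Function.Bijective φ :=
    hinj.bijective_of_nat_card_le (by rw [hcard, Nat.card_prod, Nat.card_zmod] ; norm_num)
  exact ⟨φ, hbij, htab⟩

/-! ## §4 The segment calculus and the engine run on the two generators (verbatim g12, PROVED) -/

/-- `seg` — datum of the linear-frame argument for Fisher's Theorem 13.2 (i), `n = 5` (see the module docstring). [folklore] -/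
private noncomputable def seg (a a' : 𝕃) (t : ℚ) : 𝕃 := (1 - (t : 𝕃)) * a + (t : 𝕃) * a'

/-- `seg_zero` — step of the linear-frame argument for Fisher's Theorem 13.2 (i), `n = 5` (see the module docstring). [folklore] -/
@[simp] private theorem seg_zero (a a' : 𝕃) : seg a a' 0 = a := by simp [seg]
/-- `seg_one` — step of the linear-frame argument for Fisher's Theorem 13.2 (i), `n = 5` (see the module docstring). [folklore] -/
@[simp] private theorem seg_one (a a' : 𝕃) : seg a a' 1 = a' := by simp [seg]

/-- `smul_seg` — step of the linear-frame argument for Fisher's Theorem 13.2 (i), `n = 5` (see the module docstring). [folklore] -/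
private theorem smul_seg (σ : 𝕃 ≃ₐ[ℚ] 𝕃) (a a' : 𝕃) (t : ℚ) : σ (seg a a' t) = seg (σ a) (σ a') t := by
  simp [seg, map_add, map_mul, map_sub]

/-- `segPoly` — datum of the linear-frame argument for Fisher's Theorem 13.2 (i), `n = 5` (see the module docstring). [folklore] -/
private noncomputable def segPoly (f : ∀ (R : Type) [CommRing R], R → R → R → R) (z a b a' b' : 𝕃) : 𝕃[X] :=
  f 𝕃[X] (C z) (C a + X * C (a' - a)) (C b + X * C (b' - b))

/-- `segPoly_eval_X` — step of the linear-frame argument for Fisher's Theorem 13.2 (i), `n = 5` (see the module docstring). [folklore] -/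
private theorem segPoly_eval_X (T : SectionTable) (x : ZMod 5 × ZMod 5) (z a b a' b' : 𝕃) (t : ℚ) :
    (segPoly (T.X x) z a b a' b').eval (t : 𝕃) = T.X x 𝕃 z (seg a a' t) (seg b b' t) := by
  have h := T.map_X x 𝕃[X] 𝕃 (Polynomial.evalRingHom (t : 𝕃)) (C z) (C a + X * C (a' - a))
    (C b + X * C (b' - b))
  simp only [Polynomial.coe_evalRingHom, eval_C, eval_add, eval_mul, eval_X] at h
  rw [segPoly, h, seg, seg]
  congr 1 <;> ring

/-- `segPoly_eval_Y` — step of the linear-frame argument for Fisher's Theorem 13.2 (i), `n = 5` (see the module docstring). [folklore] -/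
private theorem segPoly_eval_Y (T : SectionTable) (x : ZMod 5 × ZMod 5) (z a b a' b' : 𝕃) (t : ℚ) :
    (segPoly (T.Y x) z a b a' b').eval (t : 𝕃) = T.Y x 𝕃 z (seg a a' t) (seg b b' t) := by
  have h := T.map_Y x 𝕃[X] 𝕃 (Polynomial.evalRingHom (t : 𝕃)) (C z) (C a + X * C (a' - a))
    (C b + X * C (b' - b))
  simp only [Polynomial.coe_evalRingHom, eval_C, eval_add, eval_mul, eval_X] at h
  rw [segPoly, h, seg, seg]
  congr 1 <;> ring

/-- `good_cofinite` — step of the linear-frame argument for Fisher's Theorem 13.2 (i), `n = 5` (see the module docstring). [folklore] -/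
private theorem good_cofinite {a b : 𝕃} (a' b' : 𝕃) (hD : kD a b ≠ 0) :
    {t : ℚ | kD (seg a a' t) (seg b b' t) = 0}.Finite := by
  classical
  set p : 𝕃[X] := kD (C a + X * C (a' - a)) (C b + X * C (b' - b)) with hp
  have hev : ∀ t : ℚ, p.eval (t : 𝕃) = kD (seg a a' t) (seg b b' t) := by
    intro t
    have h := map_kD (Polynomial.evalRingHom (t : 𝕃)) (C a + X * C (a' - a)) (C b + X * C (b' - b))
    simp only [Polynomial.coe_evalRingHom, eval_C, eval_add, eval_mul, eval_X] at h
    rw [hp, h, seg, seg]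
    congr 1 <;> ring
  have hp0 : p ≠ 0 := by
    intro h0
    apply hD
    have h := hev 0
    rw [h0, eval_zero, seg_zero, seg_zero] at h
    exact h.symm
  have hfin : ((p.roots.toFinset : Finset 𝕃) : Set 𝕃).Finite := Finset.finite_toSet _
  refine (hfin.preimage Rat.cast_injective.injOn).subset ?_
  intro t ht
  simp only [Set.mem_preimage, Finset.mem_coe]
  rw [Multiset.mem_toFinset, Polynomial.mem_roots hp0, Polynomial.IsRoot.def, hev]
  exact ht

/-- `smul_table_X` — step of the linear-frame argument for Fisher's Theorem 13.2 (i), `n = 5` (see the module docstring). [folklore] -/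
private theorem smul_table_X (T : SectionTable) (σ : 𝕃 ≃ₐ[ℚ] 𝕃) (x : ZMod 5 × ZMod 5) (z u v : 𝕃) :
    σ (T.X x 𝕃 z u v) = T.X x 𝕃 (σ z) (σ u) (σ v) := by
  have h := T.map_X x 𝕃 𝕃 (σ : 𝕃 →+* 𝕃) z u v
  simpa using h

/-- `smul_table_Y` — step of the linear-frame argument for Fisher's Theorem 13.2 (i), `n = 5` (see the module docstring). [folklore] -/
private theorem smul_table_Y (T : SectionTable) (σ : 𝕃 ≃ₐ[ℚ] 𝕃) (x : ZMod 5 × ZMod 5) (z u v : 𝕃) :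
    σ (T.Y x 𝕃 z u v) = T.Y x 𝕃 (σ z) (σ u) (σ v) := by
  have h := T.map_Y x 𝕃 𝕃 (σ : 𝕃 →+* 𝕃) z u v
  simpa using h

/-- `relabel_rigid_of_pointwise` — step of the linear-frame argument for Fisher's Theorem 13.2 (i), `n = 5` (see the module docstring). [folklore] -/
private theorem relabel_rigid_of_pointwise (T : SectionTable) {z a b a' b' : 𝕃} (σ : 𝕃 ≃ₐ[ℚ] 𝕃)
    (x : ZMod 5 × ZMod 5) (S : Set ℚ) (hS : S.Infinite)
    (h : ∀ t ∈ S, ∃ y : ZMod 5 × ZMod 5, y ≠ 0 ∧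
      σ (T.X x 𝕃 z (seg a a' t) (seg b b' t)) = T.X y 𝕃 z (seg a a' t) (seg b b' t) ∧
      σ (T.Y x 𝕃 z (seg a a' t) (seg b b' t)) = T.Y y 𝕃 z (seg a a' t) (seg b b' t)) :
    ∃ y : ZMod 5 × ZMod 5, y ≠ 0 ∧ ∀ t : ℚ,
      σ (T.X x 𝕃 z (seg a a' t) (seg b b' t)) = T.X y 𝕃 z (seg a a' t) (seg b b' t) ∧
      σ (T.Y x 𝕃 z (seg a a' t) (seg b b' t)) = T.Y y 𝕃 z (seg a a' t) (seg b b' t) := by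
  classical
  let P : Bool → 𝕃[X] := fun i =>
    cond i (segPoly (T.X x) (σ z) (σ a) (σ b) (σ a') (σ b'))
      (segPoly (T.Y x) (σ z) (σ a) (σ b) (σ a') (σ b'))
  let Q : {y : ZMod 5 × ZMod 5 // y ≠ 0} → Bool → 𝕃[X] := fun y i =>
    cond i (segPoly (T.X y.1) z a b a' b') (segPoly (T.Y y.1) z a b a' b')
  have hS' : (((↑) : ℚ → 𝕃) '' S).Infinite := hS.image Rat.cast_injective.injOn
  have key : ∀ t' ∈ ((↑) : ℚ → 𝕃) '' S, ∃ y : {y : ZMod 5 × ZMod 5 // y ≠ 0},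
      ∀ i, (P i).eval t' = (Q y i).eval t' := by
    rintro _ ⟨t, ht, rfl⟩
    obtain ⟨y, hy0, hX, hY⟩ := h t ht
    refine ⟨⟨y, hy0⟩, fun i => ?_⟩
    cases i
    · simp only [P, Q, cond_false, segPoly_eval_Y]
      rw [← smul_seg, ← smul_seg, ← smul_table_Y]
      exact hY
    · simp only [P, Q, cond_true, segPoly_eval_X]
      rw [← smul_seg, ← smul_seg, ← smul_table_X]
      exact hX
  obtain ⟨y, hy⟩ := rigidity_engine _ hS' P Q key
  refine ⟨y.1, y.2, fun t => ⟨?_, ?_⟩⟩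
  · have e := congrArg (Polynomial.eval (t : 𝕃)) (hy true)
    simp only [P, Q, cond_true, segPoly_eval_X] at e
    rw [smul_table_X, smul_seg, smul_seg]
    exact e
  · have e := congrArg (Polynomial.eval (t : 𝕃)) (hy false)
    simp only [P, Q, cond_false, segPoly_eval_Y] at e
    rw [smul_table_Y, smul_seg, smul_seg]
    exact e

/-- The hypotheses of rigidity along a segment (g12): primitive `5`-th root, good start, and a
`ℚ`-MODEL at every good rational time (for Fisher's segment: §6, now WITHOUT L84-C6). [folklore] -/
private structure SegmentFrame (T : SectionTable) (z a b a' b' : 𝕃) : Prop where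
  hz : z ^ 4 + z ^ 3 + z ^ 2 + z + 1 = 0
  hD : kD a b ≠ 0
  model : ∀ t : ℚ, kD (seg a a' t) (seg b b' t) ≠ 0 →
    ∃ W : WeierstrassCurve ℚ, W.IsElliptic ∧ IsKleinModel W (seg a a' t) (seg b b' t)

/-- **LF2a · relabel_pointwise (PROVED from LF1).** At ONE good rational time, `σ • s_t(x)` is a non-zero
`5`-torsion point of the `ℚ`-curve `W_t`, hence `= φ_t(y) = s_t(y)` for some `y ≠ 0` (LF1 surjective;
`smul_mem_torsionPoints`, `smul_def`, `Affine.Point.map_some`, `smul_table_X/Y`). [folklore] -/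
private theorem relabel_pointwise (T : SectionTable) (hT : T.ChainCertified) {z a b a' b' : 𝕃}
    (hF : SegmentFrame T z a b a' b') (σ : 𝕃 ≃ₐ[ℚ] 𝕃) (x : ZMod 5 × ZMod 5) (hx : x ≠ 0)
    (t : ℚ) (ht : kD (seg a a' t) (seg b b' t) ≠ 0) :
    ∃ y : ZMod 5 × ZMod 5, y ≠ 0 ∧
      σ (T.X x 𝕃 z (seg a a' t) (seg b b' t)) = T.X y 𝕃 z (seg a a' t) (seg b b' t) ∧
      σ (T.Y x 𝕃 z (seg a a' t) (seg b b' t)) = T.Y y 𝕃 z (seg a a' t) (seg b b' t) := by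
  classical
  obtain ⟨W, hWell, hW⟩ := hF.model t ht
  haveI := hWell
  obtain ⟨φ, hφbij, hφT⟩ := frame T hT W hF.hz hW ht
  set σ' : Field.absoluteGaloisGroup ℚ := (Field.absoluteGaloisGroup.toAlgEquiv ℚ).symm σ with hσ'
  obtain ⟨y, hy⟩ := hφbij.2 (σ' • φ x)
  have hy0 : y ≠ 0 := by
    rintro rfl
    rw [map_zero] at hy
    have h2 : φ x = 0 := (smul_eq_zero_iff_eq σ').mp hy.symm
    exact hx (hφbij.1 (by rw [h2, map_zero]))
  refine ⟨y, hy0, ?_⟩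
  have hcoe : ((φ y : W.geomTorsion 5) : geomPoints W) =
      σ' • ((φ x : W.geomTorsion 5) : geomPoints W) := by
    rw [hy]; rfl
  rw [hφT y hy0, hφT x hx] at hcoe
  change _ = (σ : 𝕃 ≃ₐ[ℚ] 𝕃) • (Affine.Point.some _ _ (secPt_nonsingular T hT W hF.hz hW x hx) :
    (W.baseChange 𝕃).toAffine.Point) at hcoe
  rw [WeierstrassCurve.smul_def, Affine.Point.map_some] at hcoe
  injection hcoe with hX hY
  exact ⟨by simpa using hX.symm, by simpa using hY.symm⟩

/-- **LF2 · galois_relabel_rigid (PROVED from LF2a + engine + cofiniteness).** [folklore] -/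
private theorem galois_relabel_rigid (T : SectionTable) (hT : T.ChainCertified) {z a b a' b' : 𝕃}
    (hF : SegmentFrame T z a b a' b') (σ : 𝕃 ≃ₐ[ℚ] 𝕃) (x : ZMod 5 × ZMod 5) (hx : x ≠ 0) :
    ∃ y : ZMod 5 × ZMod 5, y ≠ 0 ∧ ∀ t : ℚ,
      σ (T.X x 𝕃 z (seg a a' t) (seg b b' t)) = T.X y 𝕃 z (seg a a' t) (seg b b' t) ∧
      σ (T.Y x 𝕃 z (seg a a' t) (seg b b' t)) = T.Y y 𝕃 z (seg a a' t) (seg b b' t) := by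
  have hS : ({t : ℚ | kD (seg a a' t) (seg b b' t) = 0}ᶜ).Infinite :=
    (good_cofinite a' b' hF.hD).infinite_compl
  exact relabel_rigid_of_pointwise T σ x _ hS (fun t ht => relabel_pointwise T hT hF σ x hx t ht)

/-! ## §5 LINEAR FRAME RIGIDITY (LF3) and the algebraic assembly (LF4, PROVED) -/

/-- The relabelling matrix of `σ` as a function `𝔽₅² → 𝔽₅²`, `(j,k) ↦ j·y₀ + k·y₁` (`ℕ`-multiples:
no module structure needed; additivity is never used). [folklore] -/
private def relabel (y₀ y₁ : ZMod 5 × ZMod 5) (x : ZMod 5 × ZMod 5) : ZMod 5 × ZMod 5 :=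
  x.1.val • y₀ + x.2.val • y₁

/-- **LF3 · galois_frame (PROVED from LF2 on the two generators).** For `σ` there is ONE relabelling
`g_σ = relabel y₀ y₁` such that at EVERY rational time, for every `ℚ`-model and every frame `φ_t` with
the table property, `σ • φ_t(x) = φ_t(g_σ x)`: `y_i` from `galois_relabel_rigid` on `gen i`;
`σ • φ_t(gen i) = φ_t(y_i)` by `smul_def`/`Affine.Point.map_some`/coe-injectivity; extend by
additivity of `σ •` (`smul_add`, `smul_comm` with `ℕ`) along `decomp_gen`. [folklore] -/
private theorem galois_frame (T : SectionTable) (hT : T.ChainCertified) {z a b a' b' : 𝕃}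
    (hF : SegmentFrame T z a b a' b') (σ : 𝕃 ≃ₐ[ℚ] 𝕃) :
    ∃ y₀ y₁ : ZMod 5 × ZMod 5, ∀ (t : ℚ) (W : WeierstrassCurve ℚ) [W.IsElliptic]
      (hW : IsKleinModel W (seg a a' t) (seg b b' t)) (φ : ZMod 5 × ZMod 5 →+ W.geomTorsion 5),
      (∀ (x : ZMod 5 × ZMod 5) (hx : x ≠ 0),
        ((φ x : W.geomTorsion 5) : geomPoints W) =
          (Affine.Point.some (T.X x 𝕃 z (seg a a' t) (seg b b' t)) (T.Y x 𝕃 z (seg a a' t) (seg b b' t))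
            (secPt_nonsingular T hT W hF.hz hW x hx) : (W.baseChange 𝕃).toAffine.Point)) →
      ∀ x, (Field.absoluteGaloisGroup.toAlgEquiv ℚ).symm σ • φ x = φ (relabel y₀ y₁ x) := by
  classical
  obtain ⟨y₀, hy₀0, hy₀⟩ := galois_relabel_rigid T hT hF σ (gen 0) (gen_ne_zero 0)
  obtain ⟨y₁, hy₁0, hy₁⟩ := galois_relabel_rigid T hT hF σ (gen 1) (gen_ne_zero 1)
  refine ⟨y₀, y₁, ?_⟩
  intro t W _ hW φ hφ x
  set σ' : Field.absoluteGaloisGroup ℚ := (Field.absoluteGaloisGroup.toAlgEquiv ℚ).symm σ with hσ'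
  -- Step A: the two generators are relabelled by `y₀`, `y₁`
  have hA : ∀ (i : Fin 2) (y : ZMod 5 × ZMod 5) (hy0 : y ≠ 0),
      σ (T.X (gen i) 𝕃 z (seg a a' t) (seg b b' t)) = T.X y 𝕃 z (seg a a' t) (seg b b' t) →
      σ (T.Y (gen i) 𝕃 z (seg a a' t) (seg b b' t)) = T.Y y 𝕃 z (seg a a' t) (seg b b' t) →
      σ' • φ (gen i) = φ y := by
    intro i y hy0 hX hY
    apply Subtype.ext
    show σ' • ((φ (gen i) : W.geomTorsion 5) : geomPoints W) = ((φ y : W.geomTorsion 5) : geomPoints W)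
    rw [hφ (gen i) (gen_ne_zero i), hφ y hy0]
    change (σ : 𝕃 ≃ₐ[ℚ] 𝕃) • (Affine.Point.some _ _ (secPt_nonsingular T hT W hF.hz hW (gen i)
      (gen_ne_zero i)) : (W.baseChange 𝕃).toAffine.Point) = _
    rw [WeierstrassCurve.smul_def, Affine.Point.map_some]
    exact some_congr _ _ (by simpa using hX) (by simpa using hY)
  have e0 : σ' • φ (gen 0) = φ y₀ := hA 0 y₀ hy₀0 (hy₀ t).1 (hy₀ t).2
  have e1 : σ' • φ (gen 1) = φ y₁ := hA 1 y₁ hy₁0 (hy₁ t).1 (hy₁ t).2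
  -- Step B/C: extend by additivity
  have hx : φ x = x.1.val • φ (gen 0) + x.2.val • φ (gen 1) := by
    conv_lhs => rw [decomp_gen x]
    rw [map_add, map_nsmul, map_nsmul]
  rw [hx, smul_add, smul_comm σ' x.1.val, smul_comm σ' x.2.val, e0, e1, relabel, map_add, map_nsmul,
    map_nsmul]

/-- **LF4 · congr_of_frames (PROVED, pure algebra).** Two bijective frames intertwined by the SAME
relabelling for every `σ` give an equivariant `W₁[5] ≃+ W₀[5]`: `e := φ₀ ∘ φ₁⁻¹`. [folklore] -/
private theorem congr_of_frames {W₀ W₁ : WeierstrassCurve ℚ}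
    (φ₀ : ZMod 5 × ZMod 5 →+ W₀.geomTorsion 5) (φ₁ : ZMod 5 × ZMod 5 →+ W₁.geomTorsion 5)
    (h₀ : Function.Bijective φ₀) (h₁ : Function.Bijective φ₁)
    (hg : ∀ σ : Field.absoluteGaloisGroup ℚ, ∃ g : ZMod 5 × ZMod 5 → ZMod 5 × ZMod 5,
      (∀ x, σ • φ₀ x = φ₀ (g x)) ∧ (∀ x, σ • φ₁ x = φ₁ (g x))) :
    Congr W₁ W₀ := by
  refine ⟨(AddEquiv.ofBijective φ₁ h₁).symm.trans (AddEquiv.ofBijective φ₀ h₀), fun σ P => ?_⟩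
  obtain ⟨g, hg₀, hg₁⟩ := hg σ
  obtain ⟨x, rfl⟩ := h₁.2 P
  have key : ∀ y, ((AddEquiv.ofBijective φ₁ h₁).symm.trans (AddEquiv.ofBijective φ₀ h₀)) (φ₁ y)
      = φ₀ y := by
    intro y
    rw [AddEquiv.trans_apply]
    have : (AddEquiv.ofBijective φ₁ h₁).symm (φ₁ y) = y := by
      apply (AddEquiv.ofBijective φ₁ h₁).injective
      rw [AddEquiv.apply_symm_apply, AddEquiv.ofBijective_apply]
    rw [this, AddEquiv.ofBijective_apply]
  rw [hg₁ x, key, key, hg₀ x]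

/-- **LF5 · congr_of_segmentFrame (PROVED from LF1 + LF3 + LF4).** The ends of a framed segment are
`5`-congruent. [folklore] -/
private theorem congr_of_segmentFrame (T : SectionTable) (hT : T.ChainCertified) {z a b a' b' : 𝕃}
    (hF : SegmentFrame T z a b a' b') (W₀ W₁ : WeierstrassCurve ℚ) [W₀.IsElliptic] [W₁.IsElliptic]
    (h₀ : IsKleinModel W₀ a b) (h₁ : IsKleinModel W₁ a' b') (hD₁ : kD a' b' ≠ 0) :
    Congr W₁ W₀ := by
  have h₀' : IsKleinModel W₀ (seg a a' 0) (seg b b' 0) := by simpa using h₀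
  have h₁' : IsKleinModel W₁ (seg a a' 1) (seg b b' 1) := by simpa using h₁
  have hD₀' : kD (seg a a' 0) (seg b b' 0) ≠ 0 := by simpa using hF.hD
  have hD₁' : kD (seg a a' 1) (seg b b' 1) ≠ 0 := by simpa using hD₁
  obtain ⟨φ₀, hφ₀, hφ₀T⟩ := frame T hT W₀ hF.hz h₀' hD₀'
  obtain ⟨φ₁, hφ₁, hφ₁T⟩ := frame T hT W₁ hF.hz h₁' hD₁'
  refine congr_of_frames φ₀ φ₁ hφ₀ hφ₁ fun σ => ?_
  obtain ⟨y₀, y₁, hy⟩ := galois_frame T hT hF (Field.absoluteGaloisGroup.toAlgEquiv ℚ σ)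
  refine ⟨relabel y₀ y₁, fun x => ?_, fun x => ?_⟩
  · have := hy 0 W₀ h₀' φ₀ hφ₀T x
    simpa using this
  · have := hy 1 W₁ h₁' φ₁ hφ₁T x
    simpa using this

/-! ## §6 SIGN RIGIDITY replaces L84-C6: Fisher's segment is framed (NEW) -/

/-- **L84-C4 (PROVED g9 via the Hessian chain rule; verbatim).** [Fisher2012Hessian Lemma 8.4] [folklore] -/
private theorem lemma84_C4 {F : Type*} [Field F] [CharZero F] (a b l m : F) (hD : kD a b ≠ 0) :
    C4 (kC4 a b) (kC6 a b) l m = kC4 (Mv1 a b l m) (Mv2 a b l m) := by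
  have hll := chain_ll a b l m
  have hlm := chain_lm a b l m
  have hmm := chain_mm a b l m
  have heul := klein_euler a b
  have hhess := klein_hessian (Mv1 a b l m) (Mv2 a b l m)
  have hk2 : kD a b ^ 2 ≠ 0 := pow_ne_zero _ hD
  have h2 : Dll (kC4 a b) (kC6 a b) l m * Dmm (kC4 a b) (kC6 a b) l m
      - Dlm (kC4 a b) (kC6 a b) l m ^ 2 = -17424 * kC4 (Mv1 a b l m) (Mv2 a b l m) := by
    apply mul_right_cancel₀ hk2
    linear_combination (Dmm (kC4 a b) (kC6 a b) l m * kD a b) * hll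
      + (a ^ 2 * kDaa (Mv1 a b l m) (Mv2 a b l m) + 2 * a * b * kDab (Mv1 a b l m) (Mv2 a b l m)
          + b ^ 2 * kDbb (Mv1 a b l m) (Mv2 a b l m)) * hmm
      - (Dlm (kC4 a b) (kC6 a b) l m * kD a b
          + (-(a * kDb a b) * kDaa (Mv1 a b l m) (Mv2 a b l m)
            + (a * kDa a b - b * kDb a b) * kDab (Mv1 a b l m) (Mv2 a b l m)
            + b * kDa a b * kDbb (Mv1 a b l m) (Mv2 a b l m))) * hlm
      + ((kDaa (Mv1 a b l m) (Mv2 a b l m) * kDbb (Mv1 a b l m) (Mv2 a b l m)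
          - kDab (Mv1 a b l m) (Mv2 a b l m) ^ 2) * (a * kDa a b + b * kDb a b + 12 * kD a b)) * heul
      + (144 * kD a b ^ 2) * hhess
  rw [C4, h2]
  ring

/-- **HS · Fisher's syzygy in `(λ, μ)`**: `𝔠₄³ − 𝔠₆² = (c₄³ − c₆²)·𝔇⁵` — BY NAME from the memory-light
certified module `ModFiveCongruenceHesseSyzygy` (the one-shot `field_simp; ring` proof, 64 M heartbeats, is not replayed).
[cite: Fisher2012Hessian, §8, formula (8.1), n = 5] -/
private theorem hesse_syzygy_LM {F : Type*} [Field F] [CharZero F] (c₄ c₆ l m : F) :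
    C4 c₄ c₆ l m ^ 3 - C6 c₄ c₆ l m ^ 2 = (c₄ ^ 3 - c₆ ^ 2) * D c₄ c₆ l m ^ 5 :=
  Literature.NumberTheory.EllipticCurves.HesseSyzygyFive.hesse5_syzygy c₄ c₆ l m

/-- `ℚ → ℚ̄` commutes with Fisher's invariants (PROVED, as g12 `cast_C4/cast_C6`). [folklore] -/
private theorem cast_C4 (c₄ c₆ l m : ℚ) :
    ((C4 c₄ c₆ l m : ℚ) : 𝕃) = C4 (c₄ : 𝕃) (c₆ : 𝕃) (l : 𝕃) (m : 𝕃) := by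
  simp only [C4, Dll, Dlm, Dmm]
  push_cast
  ring

/-- `cast_C6` — step of the linear-frame argument for Fisher's Theorem 13.2 (i), `n = 5` (see the module docstring). [folklore] -/
private theorem cast_C6 (c₄ c₆ l m : ℚ) :
    ((C6 c₄ c₆ l m : ℚ) : 𝕃) = C6 (c₄ : 𝕃) (c₆ : 𝕃) (l : 𝕃) (m : 𝕃) := by
  simp only [C6, C4l, C4m, Dl, Dm, Dll, Dlm, Dmm, Dlll, Dllm, Dlmm, Dmmm]
  push_cast
  ring

/-- `cast_D` — step of the linear-frame argument for Fisher's Theorem 13.2 (i), `n = 5` (see the module docstring). [folklore] -/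
private theorem cast_D (c₄ c₆ l m : ℚ) :
    ((D c₄ c₆ l m : ℚ) : 𝕃) = D (c₄ : 𝕃) (c₆ : 𝕃) (l : 𝕃) (m : 𝕃) := by
  simp only [D]
  push_cast
  ring

/-! ## §5½ (g15, FAMILY 3) The extreme fibre `j = 1728`: first-order data at `t = 0` (all PROVED) -/

section J1728Klein
variable {R : Type*} [CommRing R]

/-- NEW (g15): the partials of Klein's `c₆`-form `T = kC6`. [folklore] -/
private def kC6a (a b : R) : R :=
  -30 * a ^ 29 + 13050 * a ^ 24 * b ^ 5 + 200100 * a ^ 19 * b ^ 10 + 100050 * a ^ 9 * b ^ 20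
    - 2610 * a ^ 4 * b ^ 25
/-- `kC6b` — datum of the linear-frame argument for Fisher's Theorem 13.2 (i), `n = 5` (see the module docstring). [folklore] -/
private def kC6b (a b : R) : R :=
  2610 * a ^ 25 * b ^ 4 + 100050 * a ^ 20 * b ^ 9 + 200100 * a ^ 10 * b ^ 19 - 13050 * a ^ 5 * b ^ 24
    - 30 * b ^ 29

/-- Euler for `kC6` (degree 30). [folklore] -/
private theorem klein_euler_C6 (a b : R) : a * kC6a a b + b * kC6b a b = 30 * kC6 a b := by
  simp only [kC6, kC6a, kC6b]; ring

set_option maxHeartbeats 4000000 in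
/-- **Klein's Jacobian identity `∂(f, T)/∂(a, b) = 30·H²`** (`f = kD`, `T = kC6`, `H = kC4`; degree 40). [folklore] -/
private theorem klein_jacobi_C6 (a b : R) : kDa a b * kC6b a b - kDb a b * kC6a a b = 30 * kC4 a b ^ 2 := by
  simp only [kDa, kDb, kC4, kC6a, kC6b]; ring

set_option maxHeartbeats 4000000 in
/-- The linear Taylor coefficient of `kC6` along a line: `(kC6(a + X d₁, b + X d₂))'(0) = d₁ kC6a + d₂ kC6b`. [folklore] -/
private theorem derivative_kC6_linear_eval_zero (a b d₁ d₂ : R) :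
    (derivative (kC6 (C a + X * C d₁) (C b + X * C d₂))).eval 0 = d₁ * kC6a a b + d₂ * kC6b a b := by
  simp only [kC6, kC6a, kC6b, derivative_add, derivative_sub, derivative_neg, derivative_mul,
    derivative_pow, derivative_C, derivative_X, derivative_ofNat, eval_add, eval_sub, eval_neg,
    eval_mul, eval_pow, eval_C, eval_X, eval_ofNat, eval_one, eval_zero, Nat.cast_ofNat]
  ring

/-- **`p'(0)` on Fisher's segment** `v → M_v(l, m)`: `30·((l − 1)·kC6 v + m·kC4 v²)`. [folklore] -/
private theorem kC6_path_deriv (a b l m : R) :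
    (derivative (kC6 (C a + X * C (Mv1 a b l m - a)) (C b + X * C (Mv2 a b l m - b)))).eval 0 =
      30 * ((l - 1) * kC6 a b + m * kC4 a b ^ 2) := by
  rw [derivative_kC6_linear_eval_zero]
  have h1 := klein_euler_C6 a b
  have h2 := klein_jacobi_C6 a b
  simp only [Mv1, Mv2]
  linear_combination (l - 1) * h1 + m * h2

end J1728Klein

section J1728Hesse
variable {R : Type*} [CommRing R]

/-! ### values at `t = 0` of the nine partials along `L = 1 − X + X·l`, `M = X·m` -/

/-- `Dl_path_eval` — step of the linear-frame argument for Fisher's Theorem 13.2 (i), `n = 5` (see the module docstring). [folklore] -/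
private theorem Dl_path_eval (c₄ c₆ l m : R) :
    (Dl (C c₄) (C c₆) (1 - X + X * C l) (X * C m)).eval 0 = 12 := by
  simp only [Dl, eval_add, eval_sub, eval_mul, eval_pow, eval_C, eval_X, eval_ofNat, eval_one]
  ring
/-- `Dm_path_eval` — step of the linear-frame argument for Fisher's Theorem 13.2 (i), `n = 5` (see the module docstring). [folklore] -/
private theorem Dm_path_eval (c₄ c₆ l m : R) :
    (Dm (C c₄) (C c₆) (1 - X + X * C l) (X * C m)).eval 0 = 0 := by
  simp only [Dm, eval_add, eval_sub, eval_neg, eval_mul, eval_pow, eval_C, eval_X, eval_ofNat, eval_one]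
  ring
/-- `Dll_path_eval` — step of the linear-frame argument for Fisher's Theorem 13.2 (i), `n = 5` (see the module docstring). [folklore] -/
private theorem Dll_path_eval (c₄ c₆ l m : R) :
    (Dll (C c₄) (C c₆) (1 - X + X * C l) (X * C m)).eval 0 = 132 := by
  simp only [Dll, eval_add, eval_sub, eval_mul, eval_pow, eval_C, eval_X, eval_ofNat, eval_one]
  ring
/-- `Dlm_path_eval` — step of the linear-frame argument for Fisher's Theorem 13.2 (i), `n = 5` (see the module docstring). [folklore] -/
private theorem Dlm_path_eval (c₄ c₆ l m : R) :
    (Dlm (C c₄) (C c₆) (1 - X + X * C l) (X * C m)).eval 0 = 0 := by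
  simp only [Dlm, eval_add, eval_sub, eval_neg, eval_mul, eval_pow, eval_C, eval_X, eval_ofNat, eval_one]
  ring
/-- `Dmm_path_eval` — step of the linear-frame argument for Fisher's Theorem 13.2 (i), `n = 5` (see the module docstring). [folklore] -/
private theorem Dmm_path_eval (c₄ c₆ l m : R) :
    (Dmm (C c₄) (C c₆) (1 - X + X * C l) (X * C m)).eval 0 = -132 * c₄ := by
  simp only [Dmm, eval_add, eval_sub, eval_neg, eval_mul, eval_pow, eval_C, eval_X, eval_ofNat, eval_one]
  ring
/-- `Dlll_path_eval` — step of the linear-frame argument for Fisher's Theorem 13.2 (i), `n = 5` (see the module docstring). [folklore] -/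
private theorem Dlll_path_eval (c₄ c₆ l m : R) :
    (Dlll (C c₄) (C c₆) (1 - X + X * C l) (X * C m)).eval 0 = 1320 := by
  simp only [Dlll, eval_add, eval_sub, eval_mul, eval_pow, eval_C, eval_X, eval_ofNat, eval_one]
  ring
/-- `Dllm_path_eval` — step of the linear-frame argument for Fisher's Theorem 13.2 (i), `n = 5` (see the module docstring). [folklore] -/
private theorem Dllm_path_eval (c₄ c₆ l m : R) :
    (Dllm (C c₄) (C c₆) (1 - X + X * C l) (X * C m)).eval 0 = 0 := by
  simp only [Dllm, eval_add, eval_sub, eval_neg, eval_mul, eval_pow, eval_C, eval_X, eval_ofNat, eval_one]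
  ring
/-- `Dlmm_path_eval` — step of the linear-frame argument for Fisher's Theorem 13.2 (i), `n = 5` (see the module docstring). [folklore] -/
private theorem Dlmm_path_eval (c₄ c₆ l m : R) :
    (Dlmm (C c₄) (C c₆) (1 - X + X * C l) (X * C m)).eval 0 = -1320 * c₄ := by
  simp only [Dlmm, eval_add, eval_sub, eval_neg, eval_mul, eval_pow, eval_C, eval_X, eval_ofNat, eval_one]
  ring
/-- `Dmmm_path_eval` — step of the linear-frame argument for Fisher's Theorem 13.2 (i), `n = 5` (see the module docstring). [folklore] -/
private theorem Dmmm_path_eval (c₄ c₆ l m : R) :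
    (Dmmm (C c₄) (C c₆) (1 - X + X * C l) (X * C m)).eval 0 = -2640 * c₆ := by
  simp only [Dmmm, eval_add, eval_sub, eval_neg, eval_mul, eval_pow, eval_C, eval_X, eval_ofNat, eval_one]
  ring

/-! ### first derivatives at `t = 0` (path derivative `δF = (l−1)·F_λ(1,0) + m·F_μ(1,0)`) -/

/-- `Dl_path_deriv` — step of the linear-frame argument for Fisher's Theorem 13.2 (i), `n = 5` (see the module docstring). [folklore] -/
private theorem Dl_path_deriv (c₄ c₆ l m : R) :
    (derivative (Dl (C c₄) (C c₆) (1 - X + X * C l) (X * C m))).eval 0 = 132 * (l - 1) := by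
  simp only [Dl, derivative_add, derivative_sub, derivative_mul, derivative_pow,
    derivative_C, derivative_X, derivative_ofNat, derivative_one, eval_add, eval_sub, eval_mul,
    eval_pow, eval_C, eval_X, eval_ofNat, eval_one, eval_zero, Nat.cast_ofNat]
  ring
/-- `Dm_path_deriv` — step of the linear-frame argument for Fisher's Theorem 13.2 (i), `n = 5` (see the module docstring). [folklore] -/
private theorem Dm_path_deriv (c₄ c₆ l m : R) :
    (derivative (Dm (C c₄) (C c₆) (1 - X + X * C l) (X * C m))).eval 0 = -132 * c₄ * m := by
  simp only [Dm, derivative_add, derivative_sub, derivative_neg, derivative_mul, derivative_pow,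
    derivative_C, derivative_X, derivative_ofNat, derivative_one, eval_add, eval_sub, eval_neg, eval_mul,
    eval_pow, eval_C, eval_X, eval_ofNat, eval_one, eval_zero, Nat.cast_ofNat]
  ring
/-- `Dll_path_deriv` — step of the linear-frame argument for Fisher's Theorem 13.2 (i), `n = 5` (see the module docstring). [folklore] -/
private theorem Dll_path_deriv (c₄ c₆ l m : R) :
    (derivative (Dll (C c₄) (C c₆) (1 - X + X * C l) (X * C m))).eval 0 = 1320 * (l - 1) := by
  simp only [Dll, derivative_add, derivative_sub, derivative_mul, derivative_pow,
    derivative_C, derivative_X, derivative_ofNat, derivative_one, eval_add, eval_sub, eval_mul,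
    eval_pow, eval_C, eval_X, eval_ofNat, eval_one, eval_zero, Nat.cast_ofNat]
  ring
/-- `Dlm_path_deriv` — step of the linear-frame argument for Fisher's Theorem 13.2 (i), `n = 5` (see the module docstring). [folklore] -/
private theorem Dlm_path_deriv (c₄ c₆ l m : R) :
    (derivative (Dlm (C c₄) (C c₆) (1 - X + X * C l) (X * C m))).eval 0 = -1320 * c₄ * m := by
  simp only [Dlm, derivative_add, derivative_sub, derivative_neg, derivative_mul, derivative_pow,
    derivative_C, derivative_X, derivative_ofNat, derivative_one, eval_add, eval_sub, eval_neg, eval_mul,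
    eval_pow, eval_C, eval_X, eval_ofNat, eval_one, eval_zero, Nat.cast_ofNat]
  ring
/-- `Dmm_path_deriv` — step of the linear-frame argument for Fisher's Theorem 13.2 (i), `n = 5` (see the module docstring). [folklore] -/
private theorem Dmm_path_deriv (c₄ c₆ l m : R) :
    (derivative (Dmm (C c₄) (C c₆) (1 - X + X * C l) (X * C m))).eval 0 =
      -1320 * c₄ * (l - 1) - 2640 * c₆ * m := by
  simp only [Dmm, derivative_add, derivative_sub, derivative_neg, derivative_mul, derivative_pow,
    derivative_C, derivative_X, derivative_ofNat, derivative_one, eval_add, eval_sub, eval_neg, eval_mul,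
    eval_pow, eval_C, eval_X, eval_ofNat, eval_one, eval_zero, Nat.cast_ofNat]
  ring
/-- `Dlll_path_deriv` — step of the linear-frame argument for Fisher's Theorem 13.2 (i), `n = 5` (see the module docstring). [folklore] -/
private theorem Dlll_path_deriv (c₄ c₆ l m : R) :
    (derivative (Dlll (C c₄) (C c₆) (1 - X + X * C l) (X * C m))).eval 0 = 11880 * (l - 1) := by
  simp only [Dlll, derivative_add, derivative_sub, derivative_mul, derivative_pow,
    derivative_C, derivative_X, derivative_ofNat, derivative_one, eval_add, eval_sub, eval_mul,
    eval_pow, eval_C, eval_X, eval_ofNat, eval_one, eval_zero, Nat.cast_ofNat]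
  ring
/-- `Dllm_path_deriv` — step of the linear-frame argument for Fisher's Theorem 13.2 (i), `n = 5` (see the module docstring). [folklore] -/
private theorem Dllm_path_deriv (c₄ c₆ l m : R) :
    (derivative (Dllm (C c₄) (C c₆) (1 - X + X * C l) (X * C m))).eval 0 = -11880 * c₄ * m := by
  simp only [Dllm, derivative_add, derivative_sub, derivative_neg, derivative_mul, derivative_pow,
    derivative_C, derivative_X, derivative_ofNat, derivative_one, eval_add, eval_sub, eval_neg, eval_mul,
    eval_pow, eval_C, eval_X, eval_ofNat, eval_one, eval_zero, Nat.cast_ofNat]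
  ring
/-- `Dlmm_path_deriv` — step of the linear-frame argument for Fisher's Theorem 13.2 (i), `n = 5` (see the module docstring). [folklore] -/
private theorem Dlmm_path_deriv (c₄ c₆ l m : R) :
    (derivative (Dlmm (C c₄) (C c₆) (1 - X + X * C l) (X * C m))).eval 0 =
      -11880 * c₄ * (l - 1) - 23760 * c₆ * m := by
  simp only [Dlmm, derivative_add, derivative_sub, derivative_neg, derivative_mul, derivative_pow,
    derivative_C, derivative_X, derivative_ofNat, derivative_one, eval_add, eval_sub, eval_neg, eval_mul,
    eval_pow, eval_C, eval_X, eval_ofNat, eval_one, eval_zero, Nat.cast_ofNat]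
  ring
/-- `Dmmm_path_deriv` — step of the linear-frame argument for Fisher's Theorem 13.2 (i), `n = 5` (see the module docstring). [folklore] -/
private theorem Dmmm_path_deriv (c₄ c₆ l m : R) :
    (derivative (Dmmm (C c₄) (C c₆) (1 - X + X * C l) (X * C m))).eval 0 =
      -35640 * c₄ ^ 2 * m - 23760 * c₆ * (l - 1) := by
  simp only [Dmmm, derivative_add, derivative_sub, derivative_neg, derivative_mul, derivative_pow,
    derivative_C, derivative_X, derivative_ofNat, derivative_one, eval_add, eval_sub, eval_neg, eval_mul,
    eval_pow, eval_C, eval_X, eval_ofNat, eval_one, eval_zero, Nat.cast_ofNat]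
  ring

/-- **`q'(0)` on Fisher's segment:** `(C6N(c₄, c₆, 1 − X + Xl, Xm))'(0) = 125452800·((l − 1)c₆ + m c₄²)`
(`125452800 = 30 · 4181760`; product rule over the eighteen atoms above). [folklore] -/
private theorem C6N_path_deriv (c₄ c₆ l m : R) :
    (derivative (C6N (C c₄) (C c₆) (1 - X + X * C l) (X * C m))).eval 0 =
      125452800 * ((l - 1) * c₆ + m * c₄ ^ 2) := by
  simp only [C6N, derivative_mul, derivative_sub, derivative_add, derivative_neg, derivative_ofNat,
    eval_mul, eval_sub, eval_add, eval_neg, eval_ofNat, zero_mul, zero_add,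
    Dl_path_eval, Dm_path_eval, Dll_path_eval, Dlm_path_eval, Dmm_path_eval, Dlll_path_eval,
    Dllm_path_eval, Dlmm_path_eval, Dmmm_path_eval, Dl_path_deriv, Dm_path_deriv, Dll_path_deriv,
    Dlm_path_deriv, Dmm_path_deriv, Dlll_path_deriv, Dllm_path_deriv, Dlmm_path_deriv, Dmmm_path_deriv]
  ring

/-- **Scalings have `𝔠₆(λ, 0) = λ³⁰ c₆`:** `C6N(c₄, c₆, L, 0) = 4181760·c₆·L³⁰`. [folklore] -/
private theorem C6N_mu_zero (c₄ c₆ L : R) : C6N c₄ c₆ L 0 = 4181760 * c₆ * L ^ 30 := by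
  simp only [C6N, Dl, Dm, Dll, Dlm, Dmm, Dlll, Dllm, Dlmm, Dmmm]
  ring

end J1728Hesse

/-- **First-order sign rigidity (NEW, replaces g13 `sign_rigidity_anchor` at `j = 1728`).**
`p = ±q`, `p(0) = q(0)`, `p'(0) = q'(0)`, and `q(0) ≠ 0 ∨ q'(0) ≠ 0 ∨ q = 0` force `p = q`
(characteristic `0`). [folklore] -/
private theorem sign_rigidity_taylor1 {L : Type*} [CommRing L] [IsDomain L] [CharZero L] (p q : L[X])
    (h : p = q ∨ p = -q) (h0 : p.eval 0 = q.eval 0)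
    (h1 : (derivative p).eval 0 = (derivative q).eval 0)
    (hq : q.eval 0 ≠ 0 ∨ (derivative q).eval 0 ≠ 0 ∨ q = 0) : p = q := by
  rcases h with h | h
  · exact h
  · rcases hq with hq | hq | hq
    · exfalso
      apply hq
      rw [h, eval_neg] at h0
      have h2 : (2 : L) * q.eval 0 = 0 := by linear_combination -h0
      exact (mul_eq_zero.mp h2).resolve_left two_ne_zero
    · exfalso
      apply hq
      rw [h, derivative_neg, eval_neg] at h1
      have h2 : (2 : L) * (derivative q).eval 0 = 0 := by linear_combination -h1
      exact (mul_eq_zero.mp h2).resolve_left two_ne_zero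
    · rw [h, hq, neg_zero]

/-- **SR0 · the squared identity (PROVED from the named identities).** Along Fisher's segment
`v_t = M_v(λ_t, μ_t)`, `λ_t = 1 − t + tλ`, `μ_t = tμ`:  `c₆^{Kl}(v_t)² = 𝔠₆(λ_t, μ_t)²` — for EVERY `t`. [folklore] -/
private theorem kC6_Mv_sq (c₄ c₆ : ℚ) {a b : 𝕃} (h4 : kC4 a b = c₄) (h6 : kC6 a b = c₆)
    (hD : kD a b ≠ 0) (l m : 𝕃) :
    kC6 (Mv1 a b l m) (Mv2 a b l m) ^ 2 = C6 (c₄ : 𝕃) (c₆ : 𝕃) l m ^ 2 := by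
  have h1 := klein_syzygy (Mv1 a b l m) (Mv2 a b l m)
  have h2 := lemma84_C4 a b l m hD
  have h3 := lemma84_D a b l m
  have h4' := klein_syzygy a b
  have h5 := hesse_syzygy_LM (c₄ : 𝕃) (c₆ : 𝕃) l m
  rw [h4, h6] at h2 h3 h4'
  set C4t := C4 (c₄ : 𝕃) (c₆ : 𝕃) l m
  set C6t := C6 (c₄ : 𝕃) (c₆ : 𝕃) l m
  set Dt := D (c₄ : 𝕃) (c₆ : 𝕃) l m
  set k4 := kC4 (Mv1 a b l m) (Mv2 a b l m)
  set k6 := kC6 (Mv1 a b l m) (Mv2 a b l m)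
  set kd := kD (Mv1 a b l m) (Mv2 a b l m)
  set kv := kD a b
  linear_combination (-1 : 𝕃) * h1 + h5 + (-(C4t ^ 2 + C4t * k4 + k4 ^ 2)) * h2 + Dt ^ 5 * h4' +
    1728 * ((Dt * kv) ^ 4 + (Dt * kv) ^ 3 * kd + (Dt * kv) ^ 2 * kd ^ 2 + Dt * kv * kd ^ 3 + kd ^ 4) * h3

/-- **SR · kC6_seg_eq_C6 (PROVED from SR0 + anchored sign rigidity).** Along Fisher's segment the
Klein `c₆` IS Fisher's `𝔠₆` — with the right sign — at EVERY rational time, provided `c₆ ≠ 0`: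
the two sides are polynomials in `t` with equal squares (SR0) and equal NON-ZERO values at `t = 0`
(`c₆^{Kl}(v) = c₆ = 𝔠₆(1,0)`, tree `C6_one_zero`).  This is what g12 needed L84-C6 (M−) for. [folklore] -/
private theorem kC6_seg_eq_C6 (c₄ c₆ l m : ℚ) {a b : 𝕃} (h4 : kC4 a b = c₄) (h6 : kC6 a b = c₆)
    (hD : kD a b ≠ 0) (t : ℚ) :
    kC6 (seg a (Mv1 a b (l : 𝕃) (m : 𝕃)) t) (seg b (Mv2 a b (l : 𝕃) (m : 𝕃)) t) =
      ((C6 c₄ c₆ (1 - t + t * l) (t * m) : ℚ) : 𝕃) := by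
  classical
  -- the two polynomials in `t`
  set a' := Mv1 a b (l : 𝕃) (m : 𝕃) with ha'
  set b' := Mv2 a b (l : 𝕃) (m : 𝕃) with hb'
  set p : 𝕃[X] := kC6 (C a + X * C (a' - a)) (C b + X * C (b' - b)) with hp
  set q : 𝕃[X] := C ((4181760 : 𝕃)⁻¹) *
    C6N (C (c₄ : 𝕃)) (C (c₆ : 𝕃)) (1 - X + X * C (l : 𝕃)) (X * C (m : 𝕃)) with hq
  have hpev : ∀ s : ℚ, p.eval (s : 𝕃) = kC6 (seg a a' s) (seg b b' s) := by
    intro s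
    have h := map_kC6 (Polynomial.evalRingHom (s : 𝕃)) (C a + X * C (a' - a)) (C b + X * C (b' - b))
    simp only [Polynomial.coe_evalRingHom, eval_C, eval_add, eval_mul, eval_X] at h
    rw [hp, h, seg, seg]
    congr 1 <;> ring
  have hqev : ∀ s : ℚ, q.eval (s : 𝕃) = ((C6 c₄ c₆ (1 - s + s * l) (s * m) : ℚ) : 𝕃) := by
    intro s
    have h := map_C6N (Polynomial.evalRingHom (s : 𝕃)) (C (c₄ : 𝕃)) (C (c₆ : 𝕃))
      (1 - X + X * C (l : 𝕃)) (X * C (m : 𝕃))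
    simp only [Polynomial.coe_evalRingHom, eval_C, eval_add, eval_sub, eval_mul, eval_X, eval_one] at h
    rw [hq, eval_mul, eval_C, h, cast_C6, C6_eq_C6N_div]
    push_cast
    ring
  -- the segment is Fisher's pencil
  have hsegMv : ∀ s : ℚ, seg a a' s = Mv1 a b (1 - (s : 𝕃) + (s : 𝕃) * l) ((s : 𝕃) * m) ∧
      seg b b' s = Mv2 a b (1 - (s : 𝕃) + (s : 𝕃) * l) ((s : 𝕃) * m) := fun s =>
    seg_eq_Mv a b (l : 𝕃) (m : 𝕃) (s : 𝕃)
  -- squares agree everywhere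
  have hsq : ∀ s' ∈ Set.range ((↑) : ℚ → 𝕃), (p.eval s') ^ 2 = (q.eval s') ^ 2 := by
    rintro _ ⟨s, rfl⟩
    rw [hpev, hqev, (hsegMv s).1, (hsegMv s).2, kC6_Mv_sq c₄ c₆ h4 h6 hD, cast_C6]
    push_cast
    ring_nf
  have hS : (Set.range ((↑) : ℚ → 𝕃)).Infinite :=
    Set.infinite_range_of_injective Rat.cast_injective
  -- FIRST-ORDER anchor at t = 0 (g15, FAMILY 3: the extreme fibre j = 1728 needs no `c₆ ≠ 0`):
  -- p(0) = q(0) = c₆ and p'(0) = q'(0) = 30((l−1)c₆ + m c₄²); p = −q would force c₆ = 0, then m = 0, then q = 0.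
  have h00 : ((0 : ℚ) : 𝕃) = 0 := Rat.cast_zero
  have hq0v : q.eval 0 = ((c₆ : ℚ) : 𝕃) := by
    rw [← h00, hqev]
    norm_num [C6_one_zero]
  have hp0 : p.eval 0 = q.eval 0 := by
    rw [hq0v, ← h00, hpev, seg_zero, seg_zero, h6]
  have hp1 : (derivative p).eval 0 =
      30 * ((((l : ℚ) : 𝕃) - 1) * ((c₆ : ℚ) : 𝕃) + ((m : ℚ) : 𝕃) * ((c₄ : ℚ) : 𝕃) ^ 2) := by
    rw [hp, ha', hb', kC6_path_deriv, h4, h6]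
  have h30 : ((4181760 : 𝕃)⁻¹) * 125452800 = 30 := by norm_num
  have hq1 : (derivative q).eval 0 =
      30 * ((((l : ℚ) : 𝕃) - 1) * ((c₆ : ℚ) : 𝕃) + ((m : ℚ) : 𝕃) * ((c₄ : ℚ) : 𝕃) ^ 2) := by
    rw [hq, derivative_C_mul, eval_mul, eval_C, C6N_path_deriv, ← mul_assoc, h30]
  have hc4 : ((c₆ : ℚ) : 𝕃) = 0 → ((c₄ : ℚ) : 𝕃) ≠ 0 := by
    intro h60 h40
    apply hD
    have h1 := klein_syzygy a b
    rw [h4, h6, h60, h40] at h1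
    have h2 : (1728 : 𝕃) * kD a b ^ 5 = 0 := by rw [← h1]; ring
    exact pow_eq_zero_iff (by norm_num) |>.mp ((mul_eq_zero.mp h2).resolve_left (by norm_num))
  have hpq : p = q := by
    refine sign_rigidity_taylor1 p q (sign_rigidity _ hS p q hsq) hp0 (hp1.trans hq1.symm) ?_
    by_cases hc6 : ((c₆ : ℚ) : 𝕃) = 0
    · by_cases hm : ((m : ℚ) : 𝕃) = 0
      · right; right
        rw [hq, hc6, hm, map_zero, mul_zero, C6N_mu_zero]
        simp
      · right; left
        rw [hq1, hc6, mul_zero, zero_add]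
        exact mul_ne_zero (by norm_num) (mul_ne_zero hm (pow_ne_zero _ (hc4 hc6)))
    · left
      rw [hq0v]
      exact hc6
  have := hpev t
  rw [hpq, hqev] at this
  exact this.symm

/-- **S4 · isElliptic_sbase_iff (PROVED).** `Δ(sbase A B) = 2⁶3⁹5¹²(A³ − B²)`. [folklore] -/
private theorem isElliptic_sbase_iff (A B : ℚ) : (sbase A B).IsElliptic ↔ A ^ 3 ≠ B ^ 2 := by
  have hΔ : (sbase A B).Δ = 2 ^ 6 * 3 ^ 9 * 5 ^ 12 * (A ^ 3 - B ^ 2) := by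
    simp only [WeierstrassCurve.Δ, WeierstrassCurve.b₂, WeierstrassCurve.b₄,
      WeierstrassCurve.b₆, WeierstrassCurve.b₈]
    ring
  rw [WeierstrassCurve.isElliptic_iff, hΔ, isUnit_iff_ne_zero, mul_ne_zero_iff, sub_ne_zero]
  norm_num

/-- **LF6 · segmentFrame_fisher (PROVED; NO L84-C6).** Fisher's segment from a torsor point of
`(c₄, c₆)`, `c₆ ≠ 0`, is framed: at a good rational `t` the model is
`W_t := sbase (𝔠₄(λ_t, μ_t)) (𝔠₆(λ_t, μ_t))` — a Klein model by `seg_eq_Mv` + L84-C4 + **SR**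
(`kC6_seg_eq_C6`) + `cast_C4`, elliptic by S4 + `klein_syzygy` at `v_t` (`D^{Kl}(v_t) ≠ 0`). [folklore] -/
private theorem segmentFrame_fisher (T : SectionTable) {z a b : 𝕃} (hz : z ^ 4 + z ^ 3 + z ^ 2 + z + 1 = 0)
    (c₄ c₆ l m : ℚ) (h4 : kC4 a b = c₄) (h6 : kC6 a b = c₆) (hD : kD a b ≠ 0) :
    SegmentFrame T z a b (Mv1 a b (l : 𝕃) (m : 𝕃)) (Mv2 a b (l : 𝕃) (m : 𝕃)) := by
  refine ⟨hz, hD, fun t ht => ?_⟩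
  have hseg := seg_eq_Mv a b (l : 𝕃) (m : 𝕃) (t : 𝕃)
  have hs1 : seg a (Mv1 a b (l : 𝕃) (m : 𝕃)) t =
      Mv1 a b ((1 - t + t * l : ℚ) : 𝕃) ((t * m : ℚ) : 𝕃) := by
    rw [seg]; push_cast; exact hseg.1
  have hs2 : seg b (Mv2 a b (l : 𝕃) (m : 𝕃)) t =
      Mv2 a b ((1 - t + t * l : ℚ) : 𝕃) ((t * m : ℚ) : 𝕃) := by
    rw [seg]; push_cast; exact hseg.2
  have hK4 : kC4 (seg a (Mv1 a b (l : 𝕃) (m : 𝕃)) t) (seg b (Mv2 a b (l : 𝕃) (m : 𝕃)) t) =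
      ((C4 c₄ c₆ (1 - t + t * l) (t * m) : ℚ) : 𝕃) := by
    rw [hs1, hs2, ← lemma84_C4 a b _ _ hD, h4, h6, cast_C4]
  have hK6 : kC6 (seg a (Mv1 a b (l : 𝕃) (m : 𝕃)) t) (seg b (Mv2 a b (l : 𝕃) (m : 𝕃)) t) =
      ((C6 c₄ c₆ (1 - t + t * l) (t * m) : ℚ) : 𝕃) :=
    kC6_seg_eq_C6 c₄ c₆ l m h4 h6 hD t
  refine ⟨sbase (C4 c₄ c₆ (1 - t + t * l) (t * m)) (C6 c₄ c₆ (1 - t + t * l) (t * m)), ?_,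
    ⟨rfl, rfl, rfl, ?_, ?_⟩⟩
  · rw [isElliptic_sbase_iff]
    intro hEq
    apply ht
    have h1 := klein_syzygy (seg a (Mv1 a b (l : 𝕃) (m : 𝕃)) t) (seg b (Mv2 a b (l : 𝕃) (m : 𝕃)) t)
    rw [hK4, hK6] at h1
    have h2 : (((C4 c₄ c₆ (1 - t + t * l) (t * m)) : ℚ) : 𝕃) ^ 3 =
        (((C6 c₄ c₆ (1 - t + t * l) (t * m)) : ℚ) : 𝕃) ^ 2 := by
      exact_mod_cast hEq
    rw [h2, sub_self] at h1
    have h3 : kD (seg a (Mv1 a b (l : 𝕃) (m : 𝕃)) t) (seg b (Mv2 a b (l : 𝕃) (m : 𝕃)) t) ^ 5 = 0 := by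
      have h1728 : (1728 : 𝕃) ≠ 0 := by norm_num
      exact (mul_eq_zero.mp h1.symm).resolve_left h1728
    exact pow_eq_zero_iff (by norm_num) |>.mp h3
  · show (((-(27 * 5 ^ 4) * C4 c₄ c₆ (1 - t + t * l) (t * m) : ℚ)) : 𝕃) = _
    rw [hK4]; push_cast; ring
  · show (((-(54 * 5 ^ 6) * C6 c₄ c₆ (1 - t + t * l) (t * m) : ℚ)) : 𝕃) = _
    rw [hK6]; push_cast; ring

/-- **I5 (S, certificate; kit j345457 A5/A9: `Res(D, c₄^{Kl}) = 5⁵⁰`, Bezout cofactors of degrees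
19/10 with denominators `≤ 5⁵`): vertices are not face centres.** [folklore] -/
private theorem kC4_ne_zero_of_kD_eq_zero {F : Type*} [Field F] [CharZero F] (x y : F) (h0 : (x, y) ≠ (0, 0)) (hD : kD x y = 0) :
    kC4 x y ≠ 0 := by
  intro h4
  apply h0
  -- `D = x·y·r` with `r = x¹⁰ − 11x⁵y⁵ − y¹⁰`, and `c₄^{Kl} ≡ 5⁵·y¹⁵(11x⁵ + y⁵) (mod r)`
  have hfac : x * y * (x ^ 10 - 11 * x ^ 5 * y ^ 5 - y ^ 10) = 0 := by
    rw [← hD]; simp only [kD]; ring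
  have hid : kC4 x y = (x ^ 10 + 239 * x ^ 5 * y ^ 5 + 3124 * y ^ 10) *
      (x ^ 10 - 11 * x ^ 5 * y ^ 5 - y ^ 10) + 3125 * y ^ 15 * (11 * x ^ 5 + y ^ 5) := by
    simp only [kC4]; ring
  have hx0 : ∀ {x y : F}, x = 0 → kC4 x y = 0 → (x, y) = (0, 0) := by
    intro x y hx h
    subst hx
    have : y ^ 20 = 0 := by simpa [kC4] using h
    rw [pow_eq_zero_iff (by norm_num)] at this
    rw [this]
  rcases mul_eq_zero.mp hfac with hxy | hr
  · rcases mul_eq_zero.mp hxy with hx | hy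
    · exact hx0 hx h4
    · subst hy
      have : x ^ 20 = 0 := by simpa [kC4] using h4
      rw [pow_eq_zero_iff (by norm_num)] at this
      rw [this]
  · rw [h4, hr, mul_zero, zero_add] at hid
    rcases mul_eq_zero.mp hid.symm with h' | h'
    · rcases mul_eq_zero.mp h' with h'' | h''
      · exact absurd h'' (by norm_num)
      · have hy : y = 0 := (pow_eq_zero_iff (by norm_num)).mp h''
        subst hy
        have hx : x ^ 10 = 0 := by simpa using hr
        rw [(pow_eq_zero_iff (by norm_num)).mp hx]
    · have hy5 : y ^ 5 = -11 * x ^ 5 := by linear_combination h'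
      have hx10 : x ^ 10 = 0 := by
        have e : x ^ 10 = x ^ 10 - 11 * x ^ 5 * y ^ 5 - y ^ 10 := by
          rw [show y ^ 10 = (y ^ 5) ^ 2 by ring, hy5]; ring
        rw [e]; exact hr
      have hx : x = 0 := (pow_eq_zero_iff (by norm_num)).mp hx10
      subst hx
      have hy : y = 0 := by
        have : y ^ 5 = 0 := by rw [hy5]; ring
        exact (pow_eq_zero_iff (by norm_num)).mp this
      rw [hy]


open _root_.Polynomial in
/-- **H2 = T1 (PROVED here; was open in g9): torsor points exist.**  Recipe (uses I5, proved above): the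
polynomial `p(a) := c₆²·c₄^{Kl}(a,1)³ − c₄³·c₆^{Kl}(a,1)²` has degree EXACTLY 60 (leading coefficient
`c₆² − c₄³ ≠ 0`), so it has a root `a₀` (`IsAlgClosed.exists_root`); `c₄^{Kl}, c₆^{Kl}` have no common
zero on `(a₀,1)` (syzygy + I5), so `v₀ = (a₀, 1)` has `c₄^{Kl}(v₀)³ : c₆^{Kl}(v₀)² = c₄³ : c₆²`; rescale
`v = λ v₀` with `λ¹⁰ = (c₆ c₄^{Kl}(v₀)) / (c₄ c₆^{Kl}(v₀))` (then `λ²⁰ = c₄/c₄^{Kl}(v₀)`,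
`λ³⁰ = c₆/c₆^{Kl}(v₀)`); the cases `c₄ = 0` / `c₆ = 0` use a root of `c₄^{Kl}(a,1)` / `c₆^{Kl}(a,1)` and a
30th / 20th root. [folklore] -/
private theorem exists_torsorPoint {F : Type*} [Field F] [IsAlgClosed F] [CharZero F] (c₄ c₆ : F) (h : c₄ ^ 3 ≠ c₆ ^ 2) :
    ∃ a b : F, kC4 a b = c₄ ∧ kC6 a b = c₆ := by
  -- the dehomogenised forms as honest polynomials
  have hA4 : kC4 (X : F[X]) 1 = X ^ 20 + 228 * X ^ 15 + 494 * X ^ 10 - 228 * X ^ 5 + 1 := by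
    simp only [kC4]; ring
  have hA6 : kC6 (X : F[X]) 1 =
      -(X ^ 30 - 522 * X ^ 25 - 10005 * X ^ 20 - 10005 * X ^ 10 + 522 * X ^ 5 + 1) := by
    simp only [kC6]; ring
  have hm4 : (kC4 (X : F[X]) 1).Monic := by rw [hA4]; monicity!
  have hd4 : (kC4 (X : F[X]) 1).natDegree = 20 := by rw [hA4]; compute_degree!
  have hm6 : (-kC6 (X : F[X]) 1).Monic := by rw [hA6, neg_neg]; monicity!
  have hd6 : (-kC6 (X : F[X]) 1).natDegree = 30 := by rw [hA6, neg_neg]; compute_degree!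
  have ev4 : ∀ a : F, (kC4 (X : F[X]) 1).eval a = kC4 a 1 := by
    intro a; rw [← Polynomial.coe_evalRingHom, map_kC4]; simp
  have ev6 : ∀ a : F, (kC6 (X : F[X]) 1).eval a = kC6 a 1 := by
    intro a; rw [← Polynomial.coe_evalRingHom, map_kC6]; simp
  -- no common zero of `c₄^{Kl}(·,1)` and `c₆^{Kl}(·,1)` (syzygy + I5)
  have hnc : ∀ a : F, kC4 a 1 = 0 → kC6 a 1 ≠ 0 := by
    intro a h4 h6
    have hs := klein_syzygy a 1
    rw [h4, h6] at hs
    have hD : kD a 1 = 0 := by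
      have h' : (1728 : F) * kD a 1 ^ 5 = 0 := by rw [← hs]; norm_num
      exact pow_eq_zero_iff (by norm_num) |>.mp ((mul_eq_zero.mp h').resolve_left (by norm_num))
    exact kC4_ne_zero_of_kD_eq_zero a 1 (by simp) hD h4
  -- roots of the one-variable forms exist
  have root4 : ∃ a : F, kC4 a 1 = 0 := by
    have hdeg : (kC4 (X : F[X]) 1).degree ≠ 0 := by
      rw [Polynomial.degree_eq_natDegree hm4.ne_zero, hd4]; decide
    obtain ⟨a, ha⟩ := IsAlgClosed.exists_root _ hdeg
    exact ⟨a, by rw [← ev4]; exact ha⟩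
  have root6 : ∃ a : F, kC6 a 1 = 0 := by
    have hdeg : (-kC6 (X : F[X]) 1).degree ≠ 0 := by
      rw [Polynomial.degree_eq_natDegree hm6.ne_zero, hd6]; decide
    obtain ⟨a, ha⟩ := IsAlgClosed.exists_root _ hdeg
    refine ⟨a, ?_⟩
    have : (-kC6 (X : F[X]) 1).eval a = 0 := ha
    rw [Polynomial.eval_neg, neg_eq_zero, ev6] at this
    exact this
  by_cases h4 : c₄ = 0
  · -- `c₄ = 0`, `c₆ ≠ 0`: a zero of `c₄^{Kl}` rescaled by a 30th root
    have h6 : c₆ ≠ 0 := by rintro rfl; apply h; rw [h4]; ring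
    obtain ⟨a, ha⟩ := root4
    have hK6 := hnc a ha
    obtain ⟨l, hl⟩ := IsAlgClosed.exists_pow_nat_eq (c₆ / kC6 a 1) (by norm_num : 0 < 30)
    refine ⟨l * a, l * 1, ?_, ?_⟩
    · rw [kC4_smul, ha, mul_zero, h4]
    · rw [kC6_smul, hl, div_mul_cancel₀ _ hK6]
  by_cases h6 : c₆ = 0
  · -- `c₆ = 0`, `c₄ ≠ 0`: a zero of `c₆^{Kl}` rescaled by a 20th root
    obtain ⟨a, ha⟩ := root6
    have hK4 : kC4 a 1 ≠ 0 := fun h4' => hnc a h4' ha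
    obtain ⟨l, hl⟩ := IsAlgClosed.exists_pow_nat_eq (c₄ / kC4 a 1) (by norm_num : 0 < 20)
    refine ⟨l * a, l * 1, ?_, ?_⟩
    · rw [kC4_smul, hl, div_mul_cancel₀ _ hK4]
    · rw [kC6_smul, ha, mul_zero, h6]
  -- generic case: a root of `P := c₆² (c₄^{Kl})³ − c₄³ (c₆^{Kl})²`, of degree 60
  obtain ⟨P, hP⟩ : ∃ P : F[X],
      P = Polynomial.C (c₆ ^ 2) * (kC4 (X : F[X]) 1) ^ 3 -
        Polynomial.C (c₄ ^ 3) * (kC6 (X : F[X]) 1) ^ 2 := ⟨_, rfl⟩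
  have hc4 : ((kC4 (X : F[X]) 1) ^ 3).coeff 60 = 1 := by
    have hm := hm4.pow 3
    have hd : ((kC4 (X : F[X]) 1) ^ 3).natDegree = 60 := by rw [hm4.natDegree_pow, hd4]
    have := hm.coeff_natDegree; rwa [hd] at this
  have hc6 : ((kC6 (X : F[X]) 1) ^ 2).coeff 60 = 1 := by
    have hm := hm6.pow 2
    have hd : ((-kC6 (X : F[X]) 1) ^ 2).natDegree = 60 := by rw [hm6.natDegree_pow, hd6]
    have := hm.coeff_natDegree; rw [hd, neg_pow, show ((-1 : F[X]) ^ 2) = 1 by norm_num,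
      one_mul] at this; exact this
  have hP60 : P.coeff 60 = c₆ ^ 2 - c₄ ^ 3 := by
    rw [hP, Polynomial.coeff_sub, Polynomial.coeff_C_mul, Polynomial.coeff_C_mul, hc4, hc6]; ring
  have hdeg : P.degree ≠ 0 := by
    intro h0
    have h60 : ((60 : ℕ) : WithBot ℕ) ≤ P.degree :=
      Polynomial.le_degree_of_ne_zero (by rw [hP60]; exact sub_ne_zero.mpr (Ne.symm h))
    rw [h0] at h60
    exact absurd h60 (by decide)
  obtain ⟨a, ha⟩ := IsAlgClosed.exists_root P hdeg
  have hPa : c₆ ^ 2 * kC4 a 1 ^ 3 - c₄ ^ 3 * kC6 a 1 ^ 2 = 0 := by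
    have : P.eval a = 0 := ha
    rwa [hP, Polynomial.eval_sub, Polynomial.eval_mul, Polynomial.eval_mul, Polynomial.eval_C,
      Polynomial.eval_C, Polynomial.eval_pow, Polynomial.eval_pow, ev4, ev6] at this
  have hK4 : kC4 a 1 ≠ 0 := by
    intro h4'
    have : c₄ ^ 3 * kC6 a 1 ^ 2 = 0 := by rw [h4'] at hPa; linear_combination -hPa
    rcases mul_eq_zero.mp this with h' | h'
    · exact h4 ((pow_eq_zero_iff (by norm_num)).mp h')
    · exact hnc a h4' ((pow_eq_zero_iff (by norm_num)).mp h')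
  have hK6 : kC6 a 1 ≠ 0 := by
    intro h6'
    have : c₆ ^ 2 * kC4 a 1 ^ 3 = 0 := by rw [h6'] at hPa; linear_combination hPa
    rcases mul_eq_zero.mp this with h' | h'
    · exact h6 ((pow_eq_zero_iff (by norm_num)).mp h')
    · exact hK4 ((pow_eq_zero_iff (by norm_num)).mp h')
  -- rescale by `λ` with `λ¹⁰ = t := (c₆/K6)/(c₄/K4)`; then `λ²⁰ K4 = c₄`, `λ³⁰ K6 = c₆`
  obtain ⟨t, ht⟩ : ∃ t : F, t = (c₆ * kC4 a 1) / (c₄ * kC6 a 1) := ⟨_, rfl⟩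
  have ht2 : t ^ 2 * kC4 a 1 = c₄ := by
    rw [ht]; field_simp; linear_combination hPa
  have ht3 : t ^ 3 * kC6 a 1 = c₆ := by
    rw [ht]; field_simp; linear_combination hPa
  obtain ⟨l, hl⟩ := IsAlgClosed.exists_pow_nat_eq t (by norm_num : 0 < 10)
  refine ⟨l * a, l * 1, ?_, ?_⟩
  · rw [kC4_smul, show l ^ 20 = (l ^ 10) ^ 2 by ring, hl, ht2]
  · rw [kC6_smul, show l ^ 30 = (l ^ 10) ^ 3 by ring, hl, ht3]

/-! ## §7 The EXTREMAL CONSUMER: F1♮ (`c₆ ≠ 0`) is all the road uses -/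

/-- **Fisher 2012, Theorem 13.2 (i) for `n = 5`, restricted to `c₆ ≠ 0` (`j(E) ≠ 1728`)**:
for `E : y² = x³ − 27c₄x − 54c₆` and the member `E' : y² = x³ − 27·𝔠₄(l,m)·x − 54·𝔠₆(l,m)` of the degree-`5`
Hesse family (`HesseFamilyFive.C4 / C6`), both elliptic, `E'[5] ≅ E[5]` as `Γ_ℚ`-modules (`Congr E' E`).
The unrestricted statement is the tree's named fact `HesseFamilyFive.thm132_geomTorsionFive_of_hesseFamily`;
the `3`–`5` switch road (`CDTThreeFiveSwitchProofs`) uses only this restricted form, PROVED below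
(`thm132_restricted_holds`). [cite: Fisher2012Hessian, Thm 13.2 (i)] -/
def thm132_restricted : Prop :=
  ∀ (E E' : WeierstrassCurve ℚ) [E.IsElliptic] [E'.IsElliptic] (c₄ c₆ l m : ℚ), c₆ ≠ 0 →
    E = ⟨0, 0, 0, -27 * c₄, -54 * c₆⟩ →
    E' = ⟨0, 0, 0, -27 * C4 c₄ c₆ l m, -54 * C6 c₄ c₆ l m⟩ → Congr E' E

/-- F1 is F1♮ plus the `j = 1728` case (trivial bookkeeping; the road needs only F1♮). [cite: Fisher2012Hessian, Thm 13.2 (i)] -/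
private theorem thm132_restricted_of_thm132 (h : thm132_geomTorsionFive_of_hesseFamily) :
    thm132_restricted := by
  intro E E' _ _ c₄ c₆ l m _ hE hE'
  exact h E E' c₄ c₆ l m hE hE'

/-- `y² = x³ − 27A x − 54B` is elliptic iff `A³ ≠ B²` (`Δ = 2⁶3⁹(A³ − B²)`; PROVED). [folklore] -/
private theorem isElliptic_base_iff (A B : ℚ) :
    (⟨0, 0, 0, -27 * A, -54 * B⟩ : WeierstrassCurve ℚ).IsElliptic ↔ A ^ 3 ≠ B ^ 2 := by
  have hΔ : (⟨0, 0, 0, -27 * A, -54 * B⟩ : WeierstrassCurve ℚ).Δ = 2 ^ 6 * 3 ^ 9 * (A ^ 3 - B ^ 2) := by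
    simp only [WeierstrassCurve.Δ, WeierstrassCurve.b₂, WeierstrassCurve.b₄, WeierstrassCurve.b₆,
      WeierstrassCurve.b₈]
    ring
  rw [WeierstrassCurve.isElliptic_iff, hΔ, isUnit_iff_ne_zero, mul_ne_zero_iff, sub_ne_zero]
  norm_num

/-- The integer model is the `u = 5⁻¹` rescaling of the `c₄c₆`-model (PROVED, `scale_smul_short`). [folklore] -/
private theorem sbase_eq (A B : ℚ) :
    sbase A B = (⟨0, 0, 0, 5 ^ 4 * (-27 * A), 5 ^ 6 * (-54 * B)⟩ : WeierstrassCurve ℚ) := by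
  ext <;> dsimp [sbase] <;> ring

/-- `congr_base_sbase` — step of the linear-frame argument for Fisher's Theorem 13.2 (i), `n = 5` (see the module docstring). [folklore] -/
private theorem congr_base_sbase (A B : ℚ) :
    Congr (⟨0, 0, 0, -27 * A, -54 * B⟩ : WeierstrassCurve ℚ) (sbase A B) := by
  have h5 : (5 : ℚ) ≠ 0 := by norm_num
  exact congr_of_smul_eq ⟨Units.mk0 (5 : ℚ)⁻¹ (inv_ne_zero h5), 0, 0, 0⟩
    (by rw [scale_smul_short 5 h5, sbase_eq])

/-- A primitive `5`-th root of unity exists in `ℚ̄` (PROVED). [folklore] -/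
private theorem exists_primitive_fifth_root : ∃ z : 𝕃, z ^ 4 + z ^ 3 + z ^ 2 + z + 1 = 0 := by
  have hdeg : (X ^ 4 + X ^ 3 + X ^ 2 + X + 1 : 𝕃[X]).natDegree = 4 := by compute_degree!
  have hne : (X ^ 4 + X ^ 3 + X ^ 2 + X + 1 : 𝕃[X]).degree ≠ 0 := by
    intro h
    have h0 := Polynomial.natDegree_eq_zero_iff_degree_le_zero.mpr (le_of_eq h)
    rw [hdeg] at h0
    exact absurd h0 (by norm_num)
  obtain ⟨z, hz⟩ := IsAlgClosed.exists_root _ hne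
  refine ⟨z, ?_⟩
  simp only [Polynomial.IsRoot.def, eval_add, eval_pow, eval_X, eval_one] at hz
  exact hz

/-- **ASSEMBLY · thm132_restricted_of_chain (PROVED given LF1 `frame`, P0♮ and the g10 lemmas).**
Torsor point `v` of `(c₄, c₆)` (T1; `c₄³ ≠ c₆²` from `E.IsElliptic`); `ζ ∈ ℚ̄`; LF6 frames Fisher's
segment; `W₀ = sbase c₄ c₆`, `W₁ = sbase (𝔠₄(l,m)) (𝔠₆(l,m))` are Klein models at `v`, `w = M_v(l,m)`
(`h4,h6` / L84-C4 + **SR at `t = 1`**); `D^{Kl}(w) ≠ 0` (else `E'` singular by the syzygy); LF5 gives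
`Congr W₁ W₀`; rescale both ends (`congr_base_sbase`, `congr_trans/congr_symm`). [cite: Fisher2012Hessian, Thm 13.2 (i)] -/
private theorem thm132_of_chain (hT : ∃ T : SectionTable, T.ChainCertified) :
    thm132_geomTorsionFive_of_hesseFamily := by
  classical
  obtain ⟨T, hT⟩ := hT
  intro E E' hEell hE'ell c₄ c₆ l m hE hE'
  subst hE hE'
  have hc : c₄ ^ 3 ≠ c₆ ^ 2 := (isElliptic_base_iff c₄ c₆).mp hEell
  have hc' : C4 c₄ c₆ l m ^ 3 ≠ C6 c₄ c₆ l m ^ 2 := (isElliptic_base_iff _ _).mp hE'ell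
  have hcL : (c₄ : 𝕃) ^ 3 ≠ (c₆ : 𝕃) ^ 2 := by exact_mod_cast hc
  obtain ⟨a, b, h4, h6⟩ := exists_torsorPoint (c₄ : 𝕃) (c₆ : 𝕃) hcL
  have hD : kD a b ≠ 0 := by
    intro h0
    apply hcL
    have h1 := klein_syzygy a b
    rw [h4, h6, h0] at h1
    have : (c₄ : 𝕃) ^ 3 - (c₆ : 𝕃) ^ 2 = 0 := by rw [h1]; ring
    exact sub_eq_zero.mp this
  obtain ⟨z, hz⟩ := exists_primitive_fifth_root
  have hF := segmentFrame_fisher T hz c₄ c₆ l m h4 h6 hD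
  -- invariants of the far end `w = M_v(l, m)`
  have e4 : kC4 (Mv1 a b (l : 𝕃) (m : 𝕃)) (Mv2 a b (l : 𝕃) (m : 𝕃)) = ((C4 c₄ c₆ l m : ℚ) : 𝕃) := by
    rw [← lemma84_C4 a b _ _ hD, h4, h6, cast_C4]
  have e6 : kC6 (Mv1 a b (l : 𝕃) (m : 𝕃)) (Mv2 a b (l : 𝕃) (m : 𝕃)) = ((C6 c₄ c₆ l m : ℚ) : 𝕃) := by
    have e := kC6_seg_eq_C6 c₄ c₆ l m h4 h6 hD 1
    rw [seg_one, seg_one] at e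
    simp only [sub_self, one_mul, zero_add] at e
    exact e
  have hD₁ : kD (Mv1 a b (l : 𝕃) (m : 𝕃)) (Mv2 a b (l : 𝕃) (m : 𝕃)) ≠ 0 := by
    intro h0
    apply hc'
    have h1 := klein_syzygy (Mv1 a b (l : 𝕃) (m : 𝕃)) (Mv2 a b (l : 𝕃) (m : 𝕃))
    rw [e4, e6, h0] at h1
    have h2 : ((C4 c₄ c₆ l m : ℚ) : 𝕃) ^ 3 = ((C6 c₄ c₆ l m : ℚ) : 𝕃) ^ 2 := by
      have : ((C4 c₄ c₆ l m : ℚ) : 𝕃) ^ 3 - ((C6 c₄ c₆ l m : ℚ) : 𝕃) ^ 2 = 0 := by rw [h1]; ring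
      exact sub_eq_zero.mp this
    exact_mod_cast h2
  -- the two integer models
  haveI hW₀ : (sbase c₄ c₆).IsElliptic := (isElliptic_sbase_iff _ _).mpr hc
  haveI hW₁ : (sbase (C4 c₄ c₆ l m) (C6 c₄ c₆ l m)).IsElliptic := (isElliptic_sbase_iff _ _).mpr hc'
  have h₀ : IsKleinModel (sbase c₄ c₆) a b := by
    refine ⟨rfl, rfl, rfl, ?_, ?_⟩
    · show (((-(27 * 5 ^ 4) * c₄ : ℚ)) : 𝕃) = _
      push_cast; rw [h4]
    · show (((-(54 * 5 ^ 6) * c₆ : ℚ)) : 𝕃) = _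
      push_cast; rw [h6]
  have h₁ : IsKleinModel (sbase (C4 c₄ c₆ l m) (C6 c₄ c₆ l m))
      (Mv1 a b (l : 𝕃) (m : 𝕃)) (Mv2 a b (l : 𝕃) (m : 𝕃)) := by
    refine ⟨rfl, rfl, rfl, ?_, ?_⟩
    · show (((-(27 * 5 ^ 4) * C4 c₄ c₆ l m : ℚ)) : 𝕃) = _
      push_cast; rw [e4]
    · show (((-(54 * 5 ^ 6) * C6 c₄ c₆ l m : ℚ)) : 𝕃) = _
      push_cast; rw [e6]
  have hCongr : Congr (sbase (C4 c₄ c₆ l m) (C6 c₄ c₆ l m)) (sbase c₄ c₆) :=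
    congr_of_segmentFrame T hT hF _ _ h₀ h₁ hD₁
  exact congr_trans (congr_base_sbase _ _) (congr_trans hCongr (congr_symm (congr_base_sbase _ _)))

/-- F1♮ from the chain (g13's consumer, now a corollary of F1 VERBATIM). [cite: Fisher2012Hessian, Thm 13.2 (i)] -/
private theorem thm132_restricted_of_chain (hT : ∃ T : SectionTable, T.ChainCertified) :
    thm132_restricted :=
  thm132_restricted_of_thm132 (thm132_of_chain hT)

/-- **THE STUB (modulo the patched road).** `road♮ : F1♮ → CDT_three_five_switch` is g11's
kernel-checked road with the one-token patch; `stub_switch ↔ CDT_three_five_switch` is `Iff.rfl`. [cite: ConradDiamondTaylor1999, proof of Thm. 7.1.2 (p. 556)] -/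
private theorem stub_switch_of_chain (road : thm132_restricted → CDT_three_five_switch)
    (hT : ∃ T : SectionTable, T.ChainCertified) : CDT_three_five_switch :=
  road (thm132_restricted_of_chain hT)

/-- **Fisher 2012, Theorem 13.2 (i), `n = 5` — the tree's named fact
`HesseFamilyFive.thm132_geomTorsionFive_of_hesseFamily` PROVED VERBATIM (no restriction, `j = 1728` included)**:
the linear frame of this file run on the certified section table `KleinQuinticSectionTable.table_chainCertified`,
with the first-order anchor at `t = 0` (k3-g15) in place of the value anchor that needed `c₆ ≠ 0`.
[cite: Fisher2012Hessian, Thm 13.2 (i)] -/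
theorem thm132_geomTorsionFive_of_hesseFamily_holds : thm132_geomTorsionFive_of_hesseFamily :=
  thm132_of_chain table_chainCertified

/-- **Fisher 2012, Theorem 13.2 (i), `n = 5`, restricted to `c₆ ≠ 0` (`j ≠ 1728`)** — the form the `3`–`5` switch road
(`CDTThreeFiveSwitchProofs`) consumes; corollary of the verbatim theorem. [cite: Fisher2012Hessian, Thm 13.2 (i)] -/
theorem thm132_restricted_holds : thm132_restricted :=
  thm132_restricted_of_thm132 thm132_geomTorsionFive_of_hesseFamily_holds

end Literature.NumberTheory.EllipticCurves.KleinQuinticTorsion
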